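import Literature.MathematicalPhysics.QuantumFieldTheory.Balaban1983to89.B3Ineq210RegularTorus
import Literature.MathematicalPhysics.QuantumFieldTheory.Balaban1983to89.B1Prop23RegularRegion
import Literature.MathematicalPhysics.QuantumFieldTheory.Balaban1983to89.B1Prop23RegularRegionSmall
import Literature.MathematicalPhysics.QuantumFieldTheory.Balaban1983to89.B1Ineq225RegularRegion
import Literature.MathematicalPhysics.QuantumFieldTheory.Balaban1983to89.B1Ineq225DerivRegularRegion
import Literature.MathematicalPhysics.QuantumFieldTheory.Balaban1983to89.B1Cor23RegularRegion
import Literature.MathematicalPhysics.QuantumFieldTheory.Balaban1983to89.B2Ineq329BlockPoincare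

/-!
# Bałaban, *(Higgs)₂,₃ quantum fields in a finite volume III* [B3] — (2.10) p. 426 AT A REGULAR NON-CONSTANT BACKGROUND `B̃ = A`
ON A REGION `Ω ⊊ T_η` (a union of big blocks), AT INTERIOR POINTS, PROVED for a concrete carrier of `B3Sect2StatementsPart2.ScaledKernels`

statement-level skeleton of published theorems with citation tags; proofs where landed; nothing here is a claim about the Yang–Mills mass gap

T. Bałaban, Commun. Math. Phys. **88** (1983) 411–445 [cite: Balaban1983Higgs3]; inputs from part I, Commun. Math. Phys. **85** (1982)
603–636 [cite: Balaban1982Higgs1] as landed in the tree.  Companion of `B3Ineq210RegularTorus` (lit-balaban r14 g17, the torus member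
`Ω = T_η`): the same printed inequality for REGIONS, i.e. for the Green's functions `G^ε_j(Ω, A)`, `C^{(j)}(Ω, A)` of a big-block union
`Ω ⊂ T_ε` ((I.2.17)/(I.2.20)/(I.2.30) with the Neumann Laplacian of `Ω`), at the points of `Ω` carrying the `R₀`-margin of Proposition I.2.1.

## What is printed (p. 426 [PDF 16], verbatim)

*"For the propagators G^η_{(j)} we apply the inequality |G^η_{(j)}(Ω, B̃; x, x′)| ≤ O(1)(L^jη)^{−d+2}e^{−δ₁(L^jη)^{−1}|x−x′|}, (2.10)
and if the propagator is differentiated, then for each differentiation, there is an additional factor (L^jη)^{−1} on the right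
side. … They all are obtained by rescaling from the η-lattice to the L^{−j}-lattice and application of Propositions I.2.1 and I.2.3."*
with the pieces of (2.6) p. 424, `G^η_k = Σ_{j=0}^{k−1} G^η_{(j)}` = the terms of (I.2.43); I p. 610, Proposition 2.1: the inequalities hold
for `x, x′ ∈ Ω` with «dist({x,x′}, Ωᶜ) ≥ R₀».

## What this file proves (`ineq210_regularRegion`), and how

§0.1 big-block unions (`B1TorusRegionHSizes.IsBigBlockUnion k K₀ Ω`) are unions of `l`-fold blocks at every `l ≤ k`; §0.2 the averaging
operators and the cuts (`Q_l1_Ω = 1_{Ω^{(l)}}Q_l`, `Q_l^*1_{Ω^{(l)}} = 1_ΩQ_l^*`, `P(A)` block-local); §0.3 the operator of (I.2.30) at level `l`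
commutes with the cut to `Ω^{(l)}`, hence (restricted inverses of commuting units) **`C^{(l)}_{Ω^{(l)}}(Ω, A) = 1_{Ω^{(l)}}C^{(l)}(Ω, A)`** —
the conditional covariance (I.2.32) on the whole block set of the region is the cut of the unconditioned one, so r14 g14's region form of
(I.2.34) bounds the entries of `C^{(l)}(Ω, A)` on `Ω^{(l)} × Ω^{(l)}`; §0.4 the engine of `B3Ineq210RegularTorus` §3 on a region — sources in
blocks outside `Ω` do not reach `Ω` (`B1Cor23RegularRegion.propagatorK_indicator_comm`), the (I.2.25) inputs are used at interior points
only; §1R the pieces (2.6) for the region operators and (2.6) itself (`sum_pieceR` ⇐ `B1Eq243HiggsModel.display243_model` +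
`propagatorK_one`); §2R the piece bounds; §3R the interior predicate (`Interior k K₀ Ω`: the lattice ball of radius `2r_S + 2L^kK₀(d+1) + 1`
around the point lies in `Ω`), the carrier `regRegionKernels` on the interior points, the transfer lemma, and the theorem, fed by p35's
(I.2.25) for big-block regions at a regular `A` (`B1Ineq225RegularRegion.norm_propagatorK_region_reg_decay_sum`,
`B1Ineq225DerivRegularRegion.norm_covDeriv_propagatorK_region_reg_decay_sum`) and r14 g14's (I.2.34) for regions at a regular `A`
(`B1Prop23RegularRegion.prop23_regular_region`, on the constant tower `towerR Ω k` whose fine regions are all `Ω`); §4R (v1.1) the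
case `Ω = T_ε` (`ineq210_regularRegion_univ`: (2.10) on the FULL torus at a regular background for EVERY `L ≥ 2`, no parity) and the
non-vacuity of the hypotheses with a PROPER region whose interior is non-empty (`regularRegion_hypotheses_nonvacuous`: a slab of cells
in a `K₀`-tiled volume, every cube size `K₀ ≥ K₀,min`).
§5R (v1.2) the same three statements with ONE SMALLNESS PARAMETER `L^kδ_A·|e| ≤ t` — no `e² ≤ E₀`, no `L^kδ_A ≤ c|e|`, every
charge (`ineq210_regularRegion_small`, `ineq210_regularRegion_explicit_small`, `ineq210_regularRegion_univ_small`,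
`regularRegion_small_hypotheses_nonvacuous`): the (I.2.34) input swapped for p35 g16's
`B1Prop23RegularRegionSmall.prop23_regular_region_small`, everything else verbatim.

## Dictionary and honest scope

`T_η ⊃ Ω`, `η = ε`; carrier `Site := {x ∈ T_ε // Interior k K₀ Ω x}` realises Prop. I.2.1's clause «dist({x,x′}, Ωᶜ) ≥ R₀» with the tree's
margin (print's `R₀` up to the constants of `B1Ineq225RegularRegion`); `dist = ε|x − x′|`; `absG j x x′ = ε^{−d}Σ_{i′}‖(G^η_{(j)}(Ω,A)e_{(x′,i′)})(x)‖`
is the kernel of the `j`-th piece of (2.6) FOR THE REGION OPERATORS, restricted to interior points (the operators are NOT modified);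
`absDG` its covariant derivative (I.1.7) in the row variable.  NOT covered: points of `Ω` closer than the margin to `Ωᶜ`; everything involving
`∂Ω`/`Ω₂` in (2.5), (2.11), (2.12) (those carrier fields are `0`, nothing is claimed about them); `m² = 0`; regions that are not unions of
`L^kK₀`-cells; volumes with `K₀ ∤ M` or fewer than three cubes a side; charges with `e² > E₀` (§3R/§4R only — §5R has no charge
restriction); the constants depend on `K₀` and are chosen after the charge data (quantifier shape of the cited inputs).  The un-subtyped form with the interior hypotheses explicit is
`ineq210_regularRegion_explicit`.  No `def … : Prop` fact, no new named fact; axioms standard.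
-/

noncomputable section

open scoped BigOperators InnerProductSpace

namespace Literature.MathematicalPhysics.QuantumFieldTheory.Balaban1983to89.B3Ineq210RegularRegion

open HiggsLattice (ChargeData ScalarField siteInner covDeriv)
open HiggsCovariance (propagatorK avgQkLin avgQkAdj E)
open HiggsAveraging (blockIter blockK mem_blockK toFinest)
open HiggsFluctMeasure (coeff221)
open B1Eq221Coordinates (fieldCoord)
open B1Eq230FluctCov (mat Ix cb fluctCovA precOpA deltaKA blockProjA cb_repr)
open B1Eq27StepAdjoint (avgQLin avgQAdjLin avgQLin_apply avgQAdjLin_apply)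
open B2Eq255Concrete (cutTo cutToLin cutToLin_apply cutTo_of_mem cutTo_of_not_mem)
open HiggsCondCov232 (condCov232 restrictInv padInv padOp restrictOp cutToLin_mul_self cutToLin_mul_compl compl_mul_cutToLin
  cutToLin_add_compl)
open B1Ineq234Concrete (val_blockIter_all avgQkAdj_apply')
open B1TorusCubeCover (half)
open B1TorusRegionHSizes (IsBigBlockUnion)
open B1Cor23RegularRegion (propagatorK_indicator_comm)
open B3Sect2StatementsPart2 (ScaledKernels)
open B2Ineq329BlockPoincare (blockIter_toFinest)
open B1Eq230FluctCovPos (isUnit_precOpA_of_le)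
open B1Eq230FluctCov (wt adjoint_transfer dotProduct_wt_mulVec mat_comp)
open B1Ineq234Concrete (rho rho_sumBound rho_eq_tdist profile profile_nonneg' nCol tdist_blockIter_le_real)
open B1Ineq227BackgroundTorus (abs_fieldCoord_le)
open B3Ineq210RegularTorus (norm_avgQkAdj_cb_le blockIter_eq_of_avgQkAdj_cb_ne_zero blockDist_le_tdist sum3_le exp_blockIter_le
  norm_apply_le_sum_coord norm_covDeriv_apply_le_sum_coord abs_mat_le_norm norm_cb_le mesh_eq_pow_mul card_Ix eq_of_cb_ne_zero
  aSeq_sq_le covDeriv_smul'' covDeriv_zero'')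
open scoped Matrix

variable {P : HiggsLattice.Params} {N : ℕ}

/-! ## §0.1 Unions of blocks: big-block unions are unions of `l`-fold blocks at every lower level -/

section Blocks

variable {k K₀ l : ℕ} {Ω : Finset (HiggsLattice.Site P 0)}

/-- `half` at two levels: `L^kK₀ = (L^lK₀)·L^{k−l}` for `l ≤ k`. [cite: Balaban1982Higgs1, (1.19) p.607] -/
theorem half_eq_half_mul (P : HiggsLattice.Params) (hl : l ≤ k) (K₀ : ℕ) :
    half P k K₀ = half P l K₀ * P.L ^ (k - l) := by
  unfold half
  have h : k = l + (k - l) := by omega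
  conv_lhs => rw [h, pow_add]
  ring

/-- **A big-block union at level `k` is a big-block union at every level `l ≤ k`** (the cells of side `L^lK₀` refine those of
side `L^kK₀`). [cite: Balaban1983RegularityDecay, §2 p.575] [cite: Balaban1982Higgs1, Prop. 2.1 p.610] -/
theorem isBigBlockUnion_of_le (hl : l ≤ k) (hΩ : IsBigBlockUnion k K₀ Ω) : IsBigBlockUnion l K₀ Ω := by
  intro x x' h
  apply hΩ
  intro μ
  rw [half_eq_half_mul P hl K₀, ← Nat.div_div_eq_div_mul, ← Nat.div_div_eq_div_mul, h μ]

/-- **A big-block union at level `k` is a union of `l`-fold blocks for every `l ≤ k`**: membership in `Ω` depends on the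
`l`-block point only. [cite: Balaban1983RegularityDecay, §2 p.575] [cite: Balaban1982Higgs1, (1.20) p.607] -/
theorem blockUnion_of_isBigBlockUnion (hl : l ≤ k) (hΩ : IsBigBlockUnion k K₀ Ω) :
    ∀ x x' : HiggsLattice.Site P 0, blockIter l x = blockIter l x' → (x ∈ Ω ↔ x' ∈ Ω) := by
  intro x x' h
  apply hΩ
  intro μ
  have hμ : (x μ).val / P.L ^ l = (x' μ).val / P.L ^ l := by
    rw [← val_blockIter_all l x μ, ← val_blockIter_all l x' μ, h]
  have hh : half P k K₀ = P.L ^ l * (P.L ^ (k - l) * K₀) := by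
    unfold half
    have h' : k = l + (k - l) := by omega
    conv_lhs => rw [h', pow_add]
    ring
  rw [hh, ← Nat.div_div_eq_div_mul, ← Nat.div_div_eq_div_mul, hμ]
  rw [← Nat.div_div_eq_div_mul, ← Nat.div_div_eq_div_mul]

/-- `Ω^{(l)} ⊂ T^{(l)}`: the `l`-block points of the sites of `Ω`. [cite: Balaban1982Higgs1, (1.20) p.607] -/
def levelSet (l : ℕ) (Ω : Finset (HiggsLattice.Site P 0)) : Finset (HiggsLattice.Site P l) := Ω.image (blockIter l)

/-- For a union of `l`-fold blocks, `x ∈ Ω ↔ x_l ∈ Ω^{(l)}`. [cite: Balaban1982Higgs1, (1.20) p.607] -/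
theorem mem_iff_blockIter_mem (hΩ : ∀ x x' : HiggsLattice.Site P 0, blockIter l x = blockIter l x' → (x ∈ Ω ↔ x' ∈ Ω))
    (x : HiggsLattice.Site P 0) : x ∈ Ω ↔ blockIter l x ∈ levelSet l Ω := by
  constructor
  · intro hx
    exact Finset.mem_image.mpr ⟨x, hx, rfl⟩
  · intro h
    obtain ⟨x', hx', hxx'⟩ := Finset.mem_image.mp h
    exact ((hΩ x' x hxx').mp hx')

end Blocks

/-! ## §0.2 The averaging operators and the cuts: `Q_l1_Ω = 1_{Ω^{(l)}}Q_l`, `Q_l^*1_{Ω^{(l)}} = 1_ΩQ_l^*`, `P(A)` is block-local -/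

section Cuts

variable (C : ChargeData N) (A : HiggsLattice.VecField P 0) {l : ℕ} {Ω : Finset (HiggsLattice.Site P 0)}

/-- `Q_l(A)(1_Ωφ) = 1_{Ω^{(l)}}(Q_l(A)φ)` for a union `Ω` of `l`-fold blocks. [cite: Balaban1982Higgs1, (2.11) p.609] -/
theorem avgQkLin_cutTo (hΩ : ∀ x x' : HiggsLattice.Site P 0, blockIter l x = blockIter l x' → (x ∈ Ω ↔ x' ∈ Ω))
    (φ : ScalarField P 0 N) : avgQkLin C A l (cutTo Ω φ) = cutTo (levelSet l Ω) (avgQkLin C A l φ) := by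
  funext y
  by_cases hy : y ∈ levelSet l Ω
  · rw [cutTo_of_mem _ _ hy]
    simp only [avgQkLin, LinearMap.pi_apply, LinearMap.smul_apply, LinearMap.coe_sum, Finset.sum_apply,
      LinearMap.coe_comp, Function.comp_apply, LinearMap.proj_apply, ContinuousLinearMap.coe_coe]
    congr 1
    refine Finset.sum_congr rfl fun x hx => ?_
    have hxΩ : x ∈ Ω := (mem_iff_blockIter_mem hΩ x).mpr (by rwa [(mem_blockK l y x).mp hx])
    rw [cutTo_of_mem _ _ hxΩ]
  · rw [cutTo_of_not_mem _ _ hy]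
    simp only [avgQkLin, LinearMap.pi_apply, LinearMap.smul_apply, LinearMap.coe_sum, Finset.sum_apply,
      LinearMap.coe_comp, Function.comp_apply, LinearMap.proj_apply, ContinuousLinearMap.coe_coe]
    rw [Finset.sum_eq_zero fun x hx => ?_, smul_zero]
    have hxΩ : x ∉ Ω := fun h => hy ((mem_blockK l y x).mp hx ▸ (mem_iff_blockIter_mem hΩ x).mp h)
    rw [cutTo_of_not_mem _ _ hxΩ, map_zero]

/-- `Q_l^*(A)(1_{Ω^{(l)}}ψ) = 1_Ω(Q_l^*(A)ψ)` for a union `Ω` of `l`-fold blocks. [cite: Balaban1982Higgs1, (2.20) p.610] -/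
theorem avgQkAdj_cutTo (hΩ : ∀ x x' : HiggsLattice.Site P 0, blockIter l x = blockIter l x' → (x ∈ Ω ↔ x' ∈ Ω))
    (ψ : ScalarField P l N) : avgQkAdj C A l (cutTo (levelSet l Ω) ψ) = cutTo Ω (avgQkAdj C A l ψ) := by
  funext x
  rw [avgQkAdj_apply']
  by_cases hx : x ∈ Ω
  · rw [cutTo_of_mem _ _ hx, cutTo_of_mem _ _ ((mem_iff_blockIter_mem hΩ x).mp hx), avgQkAdj_apply']
  · rw [cutTo_of_not_mem _ _ hx, cutTo_of_not_mem _ _ (fun h => hx ((mem_iff_blockIter_mem hΩ x).mpr h)), map_zero]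

/-- **`P(A) = Q^*(A)Q(A)` (one step) is block-local**: it commutes with the cut to a union `Λ` of `L`-blocks of `T^{(l)}`.
[cite: Balaban1982Higgs1, (2.30) p.611] -/
theorem blockProjA_cutTo {Λ : Finset (HiggsLattice.Site P l)}
    (hΛ : ∀ y y' : HiggsLattice.Site P l, HiggsLattice.blockOf y = HiggsLattice.blockOf y' → (y ∈ Λ ↔ y' ∈ Λ))
    (φ : ScalarField P l N) : blockProjA C A l (cutTo Λ φ) = cutTo Λ (blockProjA C A l φ) := by
  funext x
  simp only [blockProjA, LinearMap.coe_comp, Function.comp_apply]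
  by_cases hx : x ∈ Λ
  · rw [cutTo_of_mem _ _ hx, avgQAdjLin_apply, avgQAdjLin_apply, avgQLin_apply, avgQLin_apply,
      HiggsAveraging.avgQ_apply, HiggsAveraging.avgQ_apply]
    congr 2
    refine Finset.sum_congr rfl fun x' hx' => ?_
    have hb : HiggsLattice.blockOf x' = HiggsLattice.blockOf x := (Finset.mem_filter.mp hx').2
    rw [cutTo_of_mem _ _ ((hΛ x' x hb).mpr hx)]
  · rw [cutTo_of_not_mem _ _ hx, avgQAdjLin_apply, avgQLin_apply, HiggsAveraging.avgQ_apply,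
      Finset.sum_eq_zero (fun x' hx' => ?_), smul_zero, map_zero]
    have hb : HiggsLattice.blockOf x' = HiggsLattice.blockOf x := (Finset.mem_filter.mp hx').2
    rw [cutTo_of_not_mem _ _ (fun h => hx ((hΛ x' x hb).mp h)), map_zero]

end Cuts

/-! ## §0.3 `Δ^{(l)}(Ω, A)`'s operator commutes with the cut to `Ω^{(l)}`; so does its inverse `C^{(l)}(Ω, A)` -/

section PrecOp

variable (C : ChargeData N) (A : HiggsLattice.VecField P 0) {msq a : ℝ} {j : ℕ} {Ω : Finset (HiggsLattice.Site P 0)}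

/-- `G^ε_l(Ω, A)(1_Ωψ) = 1_Ω(G^ε_l(Ω, A)ψ)` (r14 g14's `propagatorK_indicator_comm` in `cutTo` notation).
[cite: Balaban1982Higgs1, (2.20) p.610] -/
theorem propagatorK_cutTo {l : ℕ} (hmsq : 0 < msq) (hak : 0 ≤ B1.aSeq a P.L l)
    (hΩ : ∀ x x' : HiggsLattice.Site P 0, blockIter l x = blockIter l x' → (x ∈ Ω ↔ x' ∈ Ω)) (ψ : ScalarField P 0 N) :
    propagatorK C Ω A msq a l (cutTo Ω ψ) = cutTo Ω (propagatorK C Ω A msq a l ψ) :=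
  propagatorK_indicator_comm C Ω A hmsq hak hΩ ψ

/-- `Ω^{(j+1)}` is a union of `L`-blocks of `T^{(j+1)}` when `Ω` is a union of `(j+2)`-fold blocks (`j + 1 ≤ K`).
[cite: Balaban1982Higgs1, (1.20) p.607] -/
theorem levelSet_blockUnion (hj : j + 1 ≤ P.K)
    (hΩ1 : ∀ x x' : HiggsLattice.Site P 0, blockIter (j + 1) x = blockIter (j + 1) x' → (x ∈ Ω ↔ x' ∈ Ω))
    (hΩ2 : ∀ x x' : HiggsLattice.Site P 0, blockIter (j + 2) x = blockIter (j + 2) x' → (x ∈ Ω ↔ x' ∈ Ω)) :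
    ∀ y y' : HiggsLattice.Site P (j + 1), HiggsLattice.blockOf y = HiggsLattice.blockOf y' →
      (y ∈ levelSet (j + 1) Ω ↔ y' ∈ levelSet (j + 1) Ω) := by
  intro y y' hyy'
  have hy : y ∈ levelSet (j + 1) Ω ↔ toFinest y ∈ Ω := by
    rw [mem_iff_blockIter_mem hΩ1 (toFinest y), blockIter_toFinest hj]
  have hy' : y' ∈ levelSet (j + 1) Ω ↔ toFinest y' ∈ Ω := by
    rw [mem_iff_blockIter_mem hΩ1 (toFinest y'), blockIter_toFinest hj]
  rw [hy, hy']
  apply hΩ2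
  show HiggsLattice.blockOf (blockIter (j + 1) (toFinest y)) = HiggsLattice.blockOf (blockIter (j + 1) (toFinest y'))
  rw [blockIter_toFinest hj, blockIter_toFinest hj, hyy']

/-- **The operator of (2.30) at level `j + 1` commutes with the cut to `Ω^{(j+1)}`** (`Ω` a union of `(j+1)`- and `(j+2)`-fold
blocks, `m² > 0`, `a_{j+1} ≥ 0`): `P(A)` is block-local, `Q_{j+1}G^ε_{j+1}(Ω,A)Q_{j+1}^*` maps fields supported in / off `Ω^{(j+1)}`
to the same. [cite: Balaban1982Higgs1, (2.30) p.611, (2.20) p.610] -/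
theorem cutToLin_mul_precOpA (hj : j + 1 ≤ P.K) (hmsq : 0 < msq) (hak : 0 ≤ B1.aSeq a P.L (j + 1))
    (hΩ1 : ∀ x x' : HiggsLattice.Site P 0, blockIter (j + 1) x = blockIter (j + 1) x' → (x ∈ Ω ↔ x' ∈ Ω))
    (hΩ2 : ∀ x x' : HiggsLattice.Site P 0, blockIter (j + 2) x = blockIter (j + 2) x' → (x ∈ Ω ↔ x' ∈ Ω)) :
    (cutToLin (levelSet (j + 1) Ω) : Module.End ℝ (ScalarField P (j + 1) N)) * precOpA C Ω A msq a (j + 1)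
      = precOpA C Ω A msq a (j + 1) * cutToLin (levelSet (j + 1) Ω) := by
  refine LinearMap.ext fun φ => ?_
  show cutTo (levelSet (j + 1) Ω) (precOpA C Ω A msq a (j + 1) φ)
    = precOpA C Ω A msq a (j + 1) (cutTo (levelSet (j + 1) Ω) φ)
  have hΛ := levelSet_blockUnion hj hΩ1 hΩ2
  simp only [precOpA, B1Eq230FluctCov.deltaKA_succ, LinearMap.add_apply, LinearMap.smul_apply, LinearMap.sub_apply,
    LinearMap.id_apply, LinearMap.comp_apply]
  rw [blockProjA_cutTo C A hΛ, avgQkAdj_cutTo C A hΩ1, propagatorK_cutTo C A hmsq hak hΩ1, avgQkLin_cutTo C A hΩ1]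
  simp only [← cutToLin_apply, map_add, map_sub, map_smul]

/-- **Inverses of operators commuting with a cut.** If `M` is a unit commuting with `Λ` then `M⁻¹` commutes with `Λ`.
[cite: Balaban1982Higgs1, (2.32) p.611] -/
theorem cutToLin_mul_inverse {k : ℕ} {Λ : Finset (HiggsLattice.Site P k)} {M : Module.End ℝ (ScalarField P k N)}
    (hU : IsUnit M) (hc : (cutToLin Λ : Module.End ℝ (ScalarField P k N)) * M = M * cutToLin Λ) :
    (cutToLin Λ : Module.End ℝ (ScalarField P k N)) * Ring.inverse M = Ring.inverse M * cutToLin Λ := by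
  have h1 : Ring.inverse M * M = 1 := Ring.inverse_mul_cancel _ hU
  have h2 : M * Ring.inverse M = 1 := Ring.mul_inverse_cancel _ hU
  calc (cutToLin Λ : Module.End ℝ (ScalarField P k N)) * Ring.inverse M
      = (Ring.inverse M * M) * cutToLin Λ * Ring.inverse M := by rw [h1, one_mul]
    _ = Ring.inverse M * (M * cutToLin Λ) * Ring.inverse M := by simp only [mul_assoc]
    _ = Ring.inverse M * (cutToLin Λ * M) * Ring.inverse M := by rw [hc]
    _ = Ring.inverse M * cutToLin Λ * (M * Ring.inverse M) := by simp only [mul_assoc]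
    _ = Ring.inverse M * cutToLin Λ := by rw [h2, mul_one]

/-- **The restricted inverse of an operator commuting with the cut is the cut of its inverse**:
`(M↾_Λ)^{−1} = ΛM^{−1}` when `ΛM = MΛ` and `M` is a unit. [cite: Balaban1982Higgs1, (2.32) p.611] -/
theorem restrictInv_eq_cutToLin_mul_inverse {k : ℕ} {Λ : Finset (HiggsLattice.Site P k)} {M : Module.End ℝ (ScalarField P k N)}
    (hU : IsUnit M) (hc : (cutToLin Λ : Module.End ℝ (ScalarField P k N)) * M = M * cutToLin Λ) :
    restrictInv Λ M = cutToLin Λ * Ring.inverse M := by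
  have hci := cutToLin_mul_inverse hU hc
  have hMi : M * Ring.inverse M = 1 := Ring.mul_inverse_cancel _ hU
  have hiM : Ring.inverse M * M = 1 := Ring.inverse_mul_cancel _ hU
  have hΛΛ : (cutToLin Λ : Module.End ℝ (ScalarField P k N)) * cutToLin Λ = cutToLin Λ := cutToLin_mul_self Λ
  have hcc : (cutToLin Λᶜ : Module.End ℝ (ScalarField P k N)) * cutToLin Λᶜ = cutToLin Λᶜ := cutToLin_mul_self Λᶜ
  -- the padded operator and its explicit inverse
  have hpad : padOp Λ M = M * cutToLin Λ + cutToLin Λᶜ := by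
    show cutToLin Λ * M * cutToLin Λ + cutToLin Λᶜ = _
    rw [hc, mul_assoc, hΛΛ]
  set X : Module.End ℝ (ScalarField P k N) := Ring.inverse M * cutToLin Λ + cutToLin Λᶜ with hX
  have e1 : M * cutToLin Λ * (Ring.inverse M * cutToLin Λ) = cutToLin Λ := by
    calc M * cutToLin Λ * (Ring.inverse M * cutToLin Λ) = M * (cutToLin Λ * Ring.inverse M) * cutToLin Λ := by
          simp only [mul_assoc]
      _ = M * (Ring.inverse M * cutToLin Λ) * cutToLin Λ := by rw [hci]
      _ = (M * Ring.inverse M) * (cutToLin Λ * cutToLin Λ) := by simp only [mul_assoc]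
      _ = cutToLin Λ := by rw [hMi, one_mul, hΛΛ]
  have e2 : M * cutToLin Λ * (cutToLin Λᶜ : Module.End ℝ (ScalarField P k N)) = 0 := by
    rw [mul_assoc, cutToLin_mul_compl, mul_zero]
  have e3 : (cutToLin Λᶜ : Module.End ℝ (ScalarField P k N)) * (Ring.inverse M * cutToLin Λ) = 0 := by
    rw [← hci, ← mul_assoc, compl_mul_cutToLin, zero_mul]
  have h1 : padOp Λ M * X = 1 := by
    rw [hpad, hX, add_mul, mul_add, mul_add, e1, e2, e3, hcc, add_zero, zero_add, cutToLin_add_compl]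
  have f1 : Ring.inverse M * cutToLin Λ * (M * cutToLin Λ) = cutToLin Λ := by
    calc Ring.inverse M * cutToLin Λ * (M * cutToLin Λ) = Ring.inverse M * (cutToLin Λ * M) * cutToLin Λ := by
          simp only [mul_assoc]
      _ = Ring.inverse M * (M * cutToLin Λ) * cutToLin Λ := by rw [hc]
      _ = (Ring.inverse M * M) * (cutToLin Λ * cutToLin Λ) := by simp only [mul_assoc]
      _ = cutToLin Λ := by rw [hiM, one_mul, hΛΛ]
  have f2 : Ring.inverse M * cutToLin Λ * (cutToLin Λᶜ : Module.End ℝ (ScalarField P k N)) = 0 := by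
    rw [mul_assoc, cutToLin_mul_compl, mul_zero]
  have f3 : (cutToLin Λᶜ : Module.End ℝ (ScalarField P k N)) * (M * cutToLin Λ) = 0 := by
    rw [← hc, ← mul_assoc, compl_mul_cutToLin, zero_mul]
  have h2 : X * padOp Λ M = 1 := by
    rw [hpad, hX, add_mul, mul_add, mul_add, f1, f2, f3, hcc, add_zero, zero_add, cutToLin_add_compl]
  have hUp : IsUnit (padOp Λ M) := ⟨⟨padOp Λ M, X, h1, h2⟩, rfl⟩
  have hinv : padInv Λ M = X := by
    show Ring.inverse (padOp Λ M) = X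
    calc Ring.inverse (padOp Λ M) = Ring.inverse (padOp Λ M) * (padOp Λ M * X) := by rw [h1, mul_one]
      _ = X := by rw [← mul_assoc, Ring.inverse_mul_cancel _ hUp, one_mul]
  show cutToLin Λ * padInv Λ M * cutToLin Λ = _
  rw [hinv, hX]
  calc cutToLin Λ * (Ring.inverse M * cutToLin Λ + cutToLin Λᶜ) * cutToLin Λ
      = cutToLin Λ * Ring.inverse M * (cutToLin Λ * cutToLin Λ) + cutToLin Λ * cutToLin Λᶜ * cutToLin Λ := by
        rw [mul_add, add_mul]; simp only [mul_assoc]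
    _ = cutToLin Λ * Ring.inverse M * cutToLin Λ := by rw [hΛΛ, cutToLin_mul_compl, zero_mul, add_zero]
    _ = Ring.inverse M * (cutToLin Λ * cutToLin Λ) := by rw [hci, mul_assoc]
    _ = cutToLin Λ * Ring.inverse M := by rw [hΛΛ, hci]

/-- **`C^{(j+1)}_{Ω^{(j+1)}}(Ω, A) = 1_{Ω^{(j+1)}}·C^{(j+1)}(Ω, A)`**: the conditional covariance (2.32) on the whole block set of
the region is the cut of the unconditioned one. [cite: Balaban1982Higgs1, (2.32) p.611, (2.30) p.611] -/
theorem condCov232_levelSet_eq (hj : j + 1 ≤ P.K) (hmsq : 0 < msq) (ha : 0 < a) (hL : 1 < (P.L : ℝ))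
    (hΩ1 : ∀ x x' : HiggsLattice.Site P 0, blockIter (j + 1) x = blockIter (j + 1) x' → (x ∈ Ω ↔ x' ∈ Ω))
    (hΩ2 : ∀ x x' : HiggsLattice.Site P 0, blockIter (j + 2) x = blockIter (j + 2) x' → (x ∈ Ω ↔ x' ∈ Ω)) :
    condCov232 C Ω A msq a (j + 1) (levelSet (j + 1) Ω)
      = cutToLin (levelSet (j + 1) Ω) * fluctCovA C Ω A msq a (j + 1) := by
  have hak : 0 ≤ B1.aSeq a P.L (j + 1) := (B1.aSeq_pos ha hL (by omega)).le
  exact restrictInv_eq_cutToLin_mul_inverse (isUnit_precOpA_of_le C Ω A hmsq ha hL hj)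
    (cutToLin_mul_precOpA C A hj hmsq hak hΩ1 hΩ2)

/-- **Entries**: for `s` with `x_s ∈ Ω^{(j+1)}`, `C^{(j+1)}_{Ω^{(j+1)}}(Ω, A)(s, t) = C^{(j+1)}(Ω, A)(s, t)`.
[cite: Balaban1982Higgs1, (2.32) p.611] -/
theorem mat_condCov232_levelSet (hj : j + 1 ≤ P.K) (hmsq : 0 < msq) (ha : 0 < a) (hL : 1 < (P.L : ℝ))
    (hΩ1 : ∀ x x' : HiggsLattice.Site P 0, blockIter (j + 1) x = blockIter (j + 1) x' → (x ∈ Ω ↔ x' ∈ Ω))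
    (hΩ2 : ∀ x x' : HiggsLattice.Site P 0, blockIter (j + 2) x = blockIter (j + 2) x' → (x ∈ Ω ↔ x' ∈ Ω))
    {s : HiggsLattice.Site P (j + 1) × Ix N} (hs : s.1 ∈ levelSet (j + 1) Ω) (t : HiggsLattice.Site P (j + 1) × Ix N) :
    mat (condCov232 C Ω A msq a (j + 1) (levelSet (j + 1) Ω)) s t = mat (fluctCovA C Ω A msq a (j + 1)) s t := by
  rw [B2Eq246ScalarStep.mat_apply, B2Eq246ScalarStep.mat_apply, condCov232_levelSet_eq C A hj hmsq ha hL hΩ1 hΩ2]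
  show fieldCoord (E N) _ (cutTo (levelSet (j + 1) Ω) (fluctCovA C Ω A msq a (j + 1) (cb P N (j + 1) t))) s = _
  rw [B1Eq221Coordinates.fieldCoord_apply, B1Eq221Coordinates.fieldCoord_apply, cutTo_of_mem _ _ hs]

end PrecOp

/-! ## §0.4 The engine of `B3Ineq210RegularTorus` §3 on a region: the kernel of `G^ε_l(Ω)Q_l^*C^{(l)}(Ω)Q_lG^ε_l(Ω)` at interior points,
inputs (I.2.25) at «good» (interior) points and (I.2.34) on `Ω^{(l)} × Ω^{(l)}`; sources outside `Ω` do not reach `Ω` -/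

section EngineR

variable (C : ChargeData N) (Ω : Finset (HiggsLattice.Site P 0)) (A : HiggsLattice.VecField P 0) (msq a : ℝ) {l : ℕ}


/-- The unscaled sandwich `G^ε_l(Ω,A)Q_l^*(A)C^{(l)}(Ω,A)Q_l(A)G^ε_l(Ω,A)` of the `l`-th term of (I.2.43) on a region.
[cite: Balaban1982Higgs1, (2.43) p.612] -/
def sandwichR (l : ℕ) : ScalarField P 0 N →ₗ[ℝ] ScalarField P 0 N :=
  propagatorK C Ω A msq a l ∘ₗ avgQkAdj C A l ∘ₗ fluctCovA C Ω A msq a l ∘ₗ avgQkLin C A l ∘ₗ propagatorK C Ω A msq a l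

/-- `X(p, q) = δ_p · X δ_q` for any real matrix. [folklore] -/
private theorem entry_eq_dotProduct' {m n : Type*} [Fintype m] [Fintype n] [DecidableEq m] [DecidableEq n] (X : Matrix m n ℝ)
    (p : m) (q : n) : X p q = Pi.single p (1 : ℝ) ⬝ᵥ (X *ᵥ Pi.single q (1 : ℝ)) := by
  rw [single_dotProduct, one_mul, Matrix.mulVec, dotProduct_single, mul_one]

/-- The decay factor at the block distance (as in the torus file). [folklore] -/
private theorem exp_blockDist_le' (x : HiggsLattice.Site P 0) (y : HiggsLattice.Site P l) {δ : ℝ} (hδ : 0 ≤ δ) :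
    Real.exp (-(δ * (max 0 ((P.L : ℝ) ^ l * (HiggsLattice.Site.tdist (blockIter l x) y : ℝ) - ((P.L : ℝ) ^ l - 1))
        / (P.L : ℝ) ^ l)))
      ≤ Real.exp δ * Real.exp (-(δ * (HiggsLattice.Site.tdist (blockIter l x) y : ℝ))) := by
  rw [← Real.exp_add]
  apply Real.exp_le_exp.mpr
  have hT : (0 : ℝ) < (P.L : ℝ) ^ l := pow_pos (by exact_mod_cast P.hL) l
  set t : ℝ := (HiggsLattice.Site.tdist (blockIter l x) y : ℝ) with ht
  have h2 : t - 1 ≤ max 0 ((P.L : ℝ) ^ l * t - ((P.L : ℝ) ^ l - 1)) / (P.L : ℝ) ^ l := by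
    rw [le_div_iff₀ hT]
    have h1 : (P.L : ℝ) ^ l * t - ((P.L : ℝ) ^ l - 1) ≤ max 0 ((P.L : ℝ) ^ l * t - ((P.L : ℝ) ^ l - 1)) :=
      le_max_right _ _
    nlinarith
  nlinarith [mul_le_mul_of_nonneg_left h2 hδ]

/-- **A source in a block OUTSIDE `Ω` does not reach `Ω`**: `(G^ε_l(Ω,A)Q_l^*e_s)(x) = 0` for `x ∈ Ω`, `y_s ∉ Ω^{(l)}` (`Ω` a union
of `l`-fold blocks: `G^ε_l(Ω,A)` does not couple `Ω` and `Ωᶜ`). [cite: Balaban1982Higgs1, (2.20) p.610] -/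
theorem G_avgQkAdj_cb_eq_zero (hmsq : 0 < msq) (hak : 0 ≤ B1.aSeq a P.L l)
    (hΩ : ∀ x x' : HiggsLattice.Site P 0, blockIter l x = blockIter l x' → (x ∈ Ω ↔ x' ∈ Ω))
    (s : HiggsLattice.Site P l × Ix N) (hs : s.1 ∉ levelSet l Ω) {x : HiggsLattice.Site P 0} (hx : x ∈ Ω) :
    propagatorK C Ω A msq a l (avgQkAdj C A l (cb P N l s)) x = 0 := by
  have hcut : cutTo Ω (avgQkAdj C A l (cb P N l s)) = 0 := by
    funext z
    by_cases hz : z ∈ Ω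
    · rw [cutTo_of_mem _ _ hz, Pi.zero_apply]
      by_contra hne
      exact hs ((blockIter_eq_of_avgQkAdj_cb_ne_zero C A s hne) ▸ (mem_iff_blockIter_mem hΩ z).mp hz)
    · rw [cutTo_of_not_mem _ _ hz, Pi.zero_apply]
  have h := propagatorK_cutTo C A hmsq hak hΩ (avgQkAdj C A l (cb P N l s))
  rw [hcut, map_zero] at h
  have hx' := congrFun h x
  rw [Pi.zero_apply, cutTo_of_mem _ _ hx] at hx'
  exact hx'.symm

/-- **First kernel on a region** — at an interior («good») point `x`: `‖(G^ε_l(Ω)Q_l^*e_s)(x)‖ ≤ c_Ge^{δ}e^{−δ|x_l − y_s|}√N`.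
[cite: Balaban1982Higgs1, Prop. 2.1 (2.25) p.610] -/
theorem norm_G_avgQkAdj_cb_le_R (hl : l ≤ P.K) {good : HiggsLattice.Site P 0 → Prop} {cG δ : ℝ} (hcG : 0 ≤ cG) (hδ : 0 ≤ δ)
    (hG : ∀ (g : ScalarField P 0 N) (M D : ℝ), (∀ x, ‖g x‖ ≤ M) → 0 ≤ D →
      ∀ x, good x → (∀ z, g z ≠ 0 → D ≤ (HiggsLattice.Site.tdist x z : ℝ)) →
        ‖propagatorK C Ω A msq a l g x‖ ≤ cG * Real.exp (-(δ * (D / (P.L : ℝ) ^ l))) * M)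
    (s : HiggsLattice.Site P l × Ix N) {x : HiggsLattice.Site P 0} (hx : good x) :
    ‖propagatorK C Ω A msq a l (avgQkAdj C A l (cb P N l s)) x‖
      ≤ cG * Real.exp δ * Real.exp (-(δ * (HiggsLattice.Site.tdist (blockIter l x) s.1 : ℝ))) * Real.sqrt N := by
  set D : ℝ := max 0 ((P.L : ℝ) ^ l * (HiggsLattice.Site.tdist (blockIter l x) s.1 : ℝ) - ((P.L : ℝ) ^ l - 1)) with hD
  have h := hG (avgQkAdj C A l (cb P N l s)) (Real.sqrt N) D (norm_avgQkAdj_cb_le C A s) (le_max_left _ _) x hx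
    (fun z hz => blockDist_le_tdist hl x s.1 (blockIter_eq_of_avgQkAdj_cb_ne_zero C A s hz))
  refine h.trans ?_
  have he := exp_blockDist_le' (P := P) x s.1 hδ
  have hsq : 0 ≤ Real.sqrt (N : ℝ) := Real.sqrt_nonneg _
  calc cG * Real.exp (-(δ * (D / (P.L : ℝ) ^ l))) * Real.sqrt N
      ≤ cG * (Real.exp δ * Real.exp (-(δ * (HiggsLattice.Site.tdist (blockIter l x) s.1 : ℝ)))) * Real.sqrt N :=
        mul_le_mul_of_nonneg_right (mul_le_mul_of_nonneg_left he hcG) hsq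
    _ = _ := by ring

/-- **First kernel on a region, differentiated** — at a bond with a good source point. [cite: Balaban1982Higgs1, Prop. 2.1 (2.25) p.610] -/
theorem norm_covDeriv_G_avgQkAdj_cb_le_R (hl : l ≤ P.K) {good : HiggsLattice.Site P 0 → Prop} {cD δ : ℝ} (hcD : 0 ≤ cD)
    (hδ : 0 ≤ δ)
    (hDG : ∀ (g : ScalarField P 0 N) (M D : ℝ), (∀ x, ‖g x‖ ≤ M) → 0 ≤ D →
      ∀ b : HiggsLattice.PBond P 0, good b.src → (∀ z, g z ≠ 0 → D ≤ (HiggsLattice.Site.tdist b.src z : ℝ)) →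
        ‖covDeriv C A (propagatorK C Ω A msq a l g) b‖ ≤ cD * Real.exp (-(δ * (D / (P.L : ℝ) ^ l))) * M)
    (s : HiggsLattice.Site P l × Ix N) {b : HiggsLattice.PBond P 0} (hb : good b.src) :
    ‖covDeriv C A (propagatorK C Ω A msq a l (avgQkAdj C A l (cb P N l s))) b‖
      ≤ cD * Real.exp δ * Real.exp (-(δ * (HiggsLattice.Site.tdist (blockIter l b.src) s.1 : ℝ))) * Real.sqrt N := by
  set D : ℝ := max 0 ((P.L : ℝ) ^ l * (HiggsLattice.Site.tdist (blockIter l b.src) s.1 : ℝ) - ((P.L : ℝ) ^ l - 1)) with hD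
  have h := hDG (avgQkAdj C A l (cb P N l s)) (Real.sqrt N) D (norm_avgQkAdj_cb_le C A s) (le_max_left _ _) b hb
    (fun z hz => blockDist_le_tdist hl b.src s.1 (blockIter_eq_of_avgQkAdj_cb_ne_zero C A s hz))
  refine h.trans ?_
  have he := exp_blockDist_le' (P := P) b.src s.1 hδ
  have hsq : 0 ≤ Real.sqrt (N : ℝ) := Real.sqrt_nonneg _
  calc cD * Real.exp (-(δ * (D / (P.L : ℝ) ^ l))) * Real.sqrt N
      ≤ cD * (Real.exp δ * Real.exp (-(δ * (HiggsLattice.Site.tdist (blockIter l b.src) s.1 : ℝ)))) * Real.sqrt N :=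
        mul_le_mul_of_nonneg_right (mul_le_mul_of_nonneg_left he hcD) hsq
    _ = _ := by ring

/-- `Q_l(A)G^ε_l(Ω,A)` and `G^ε_l(Ω,A)Q_l^*(A)` are adjoint for the products (1.5). [cite: Balaban1982Higgs1, (2.20) p.610] -/
theorem siteInner_QG_adjoint_R (f : ScalarField P 0 N) (g : ScalarField P l N) :
    siteInner ((avgQkLin C A l ∘ₗ propagatorK C Ω A msq a l) f) g
      = siteInner f ((propagatorK C Ω A msq a l ∘ₗ avgQkAdj C A l) g) := by
  rw [LinearMap.comp_apply, LinearMap.comp_apply, HiggsCovariancePos.siteInner_avgQkLin, HiggsFluctMeasurePos.siteInner_comm,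
    B1Eq230FluctCovPos.siteInner_propagatorK_comm C Ω A msq a l f]

/-- **`(Q_lG^ε_l(Ω))(t, q) = L^{−ld}·(G^ε_l(Ω)Q_l^*)(q, t)`**. [cite: Balaban1982Higgs1, (1.5) p.604, (2.20) p.610] -/
theorem mat_QG_eq_R (t : HiggsLattice.Site P l × Ix N) (q : HiggsLattice.Site P 0 × Ix N) :
    mat (avgQkLin C A l ∘ₗ propagatorK C Ω A msq a l) t q
      = (((P.L : ℝ) ^ l) ^ P.d)⁻¹ * mat (propagatorK C Ω A msq a l ∘ₗ avgQkAdj C A l) q t := by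
  have h := adjoint_transfer (X := avgQkLin C A l ∘ₗ propagatorK C Ω A msq a l)
    (Xs := propagatorK C Ω A msq a l ∘ₗ avgQkAdj C A l) (siteInner_QG_adjoint_R C Ω A msq a)
    (Pi.single q 1) (Pi.single t 1)
  rw [dotProduct_wt_mulVec, dotProduct_wt_mulVec, ← entry_eq_dotProduct', dotProduct_comm, ← entry_eq_dotProduct',
    mesh_eq_pow_mul P l, mul_pow] at h
  have hm : (0 : ℝ) < P.mesh 0 ^ P.d := pow_pos (P.mesh_pos 0) _
  have hL : (0 : ℝ) < ((P.L : ℝ) ^ l) ^ P.d := pow_pos (pow_pos (by exact_mod_cast P.hL) l) _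
  rw [eq_inv_mul_iff_mul_eq₀ hL.ne']
  have h' : P.mesh 0 ^ P.d * (((P.L : ℝ) ^ l) ^ P.d * mat (avgQkLin C A l ∘ₗ propagatorK C Ω A msq a l) t q)
      = P.mesh 0 ^ P.d * mat (propagatorK C Ω A msq a l ∘ₗ avgQkAdj C A l) q t := by
    rw [h]; ring
  exact mul_left_cancel₀ hm.ne' h'

/-- **Third kernel on a region** at a good `x_q`. [cite: Balaban1982Higgs1, Prop. 2.1 (2.25) p.610, (2.20) p.610] -/
theorem abs_mat_QG_le_R (hl : l ≤ P.K) {good : HiggsLattice.Site P 0 → Prop} {cG δ : ℝ} (hcG : 0 ≤ cG) (hδ : 0 ≤ δ)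
    (hG : ∀ (g : ScalarField P 0 N) (M D : ℝ), (∀ x, ‖g x‖ ≤ M) → 0 ≤ D →
      ∀ x, good x → (∀ z, g z ≠ 0 → D ≤ (HiggsLattice.Site.tdist x z : ℝ)) →
        ‖propagatorK C Ω A msq a l g x‖ ≤ cG * Real.exp (-(δ * (D / (P.L : ℝ) ^ l))) * M)
    (t : HiggsLattice.Site P l × Ix N) {q : HiggsLattice.Site P 0 × Ix N} (hq : good q.1) :
    |mat (avgQkLin C A l ∘ₗ propagatorK C Ω A msq a l) t q|
      ≤ (((P.L : ℝ) ^ l) ^ P.d)⁻¹ *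
        (cG * Real.exp δ * Real.exp (-(δ * (HiggsLattice.Site.tdist (blockIter l q.1) t.1 : ℝ))) * Real.sqrt N) := by
  have hLd : (0 : ℝ) ≤ (((P.L : ℝ) ^ l) ^ P.d)⁻¹ := inv_nonneg.mpr (pow_nonneg (pow_nonneg (Nat.cast_nonneg _) l) _)
  rw [mat_QG_eq_R, abs_mul, abs_of_nonneg hLd]
  refine mul_le_mul_of_nonneg_left ?_ hLd
  refine (abs_mat_le_norm _ q t).trans ?_
  rw [LinearMap.comp_apply]
  exact norm_G_avgQkAdj_cb_le_R C Ω A msq a hl hcG hδ hG t hq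

/-- **Third kernel vanishes for block points outside `Ω^{(l)}`** at `x_q ∈ Ω`. [cite: Balaban1982Higgs1, (2.20) p.610] -/
theorem mat_QG_eq_zero_R (hmsq : 0 < msq) (hak : 0 ≤ B1.aSeq a P.L l)
    (hΩ : ∀ x x' : HiggsLattice.Site P 0, blockIter l x = blockIter l x' → (x ∈ Ω ↔ x' ∈ Ω))
    (t : HiggsLattice.Site P l × Ix N) (ht : t.1 ∉ levelSet l Ω) {q : HiggsLattice.Site P 0 × Ix N} (hq : q.1 ∈ Ω) :
    mat (avgQkLin C A l ∘ₗ propagatorK C Ω A msq a l) t q = 0 := by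
  rw [mat_QG_eq_R, B2Eq246ScalarStep.mat_apply, LinearMap.comp_apply, B1Eq221Coordinates.fieldCoord_apply,
    G_avgQkAdj_cb_eq_zero C Ω A msq a hmsq hak hΩ t ht hq]
  simp

/-- **The coordinates of `C^{(l)}(Ω)Q_lG^ε_l(Ω)e_q`** (as in the torus file). [cite: Balaban1982Higgs1, (2.43) p.612] -/
theorem abs_coord_CQG_le_R (s : HiggsLattice.Site P l × Ix N) (q : HiggsLattice.Site P 0 × Ix N) :
    |fieldCoord (E N) (HiggsLattice.Site P l)
        (fluctCovA C Ω A msq a l (avgQkLin C A l (propagatorK C Ω A msq a l (cb P N 0 q)))) s|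
      ≤ ∑ t : HiggsLattice.Site P l × Ix N, |mat (fluctCovA C Ω A msq a l) s t| *
          |mat (avgQkLin C A l ∘ₗ propagatorK C Ω A msq a l) t q| := by
  have h : fieldCoord (E N) (HiggsLattice.Site P l)
        (fluctCovA C Ω A msq a l (avgQkLin C A l (propagatorK C Ω A msq a l (cb P N 0 q)))) s
      = mat (fluctCovA C Ω A msq a l ∘ₗ (avgQkLin C A l ∘ₗ propagatorK C Ω A msq a l)) s q := by
    rw [B2Eq246ScalarStep.mat_apply]; rfl
  rw [h, mat_comp, Matrix.mul_apply]
  exact (Finset.abs_sum_le_sum_abs _ _).trans (le_of_eq (Finset.sum_congr rfl fun t _ => abs_mul _ _))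

/-- **The middle sum on a region**: for `y_s ∈ Ω^{(l)}` and a good `x_q ∈ Ω`,
`Σ_t |C^{(l)}(Ω)(s,t)|·|(Q_lG^ε_l(Ω))(t,q)| ≤ Σ_t c_Ce^{−δ|y_s−y_t|}·L^{−ld}c_Ge^{δ}e^{−δ|(x_q)_l − y_t|}√N` — the entries with `y_t ∉ Ω^{(l)}`
vanish by the third kernel, the others are bounded by (I.2.34) on `Ω^{(l)}`. [cite: Balaban1982Higgs1, Prop. 2.3 (2.34) p.611] -/
theorem sum_CQG_le_R (hl : l ≤ P.K) (hmsq : 0 < msq) (hak : 0 ≤ B1.aSeq a P.L l)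
    (hΩ : ∀ x x' : HiggsLattice.Site P 0, blockIter l x = blockIter l x' → (x ∈ Ω ↔ x' ∈ Ω))
    {good : HiggsLattice.Site P 0 → Prop} (hgood : ∀ x, good x → x ∈ Ω) {cG cC δ : ℝ} (hcG : 0 ≤ cG) (hcC : 0 ≤ cC) (hδ : 0 ≤ δ)
    (hG : ∀ (g : ScalarField P 0 N) (M D : ℝ), (∀ x, ‖g x‖ ≤ M) → 0 ≤ D →
      ∀ x, good x → (∀ z, g z ≠ 0 → D ≤ (HiggsLattice.Site.tdist x z : ℝ)) →
        ‖propagatorK C Ω A msq a l g x‖ ≤ cG * Real.exp (-(δ * (D / (P.L : ℝ) ^ l))) * M)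
    (hC : ∀ s t : HiggsLattice.Site P l × Ix N, s.1 ∈ levelSet l Ω → t.1 ∈ levelSet l Ω →
      |mat (fluctCovA C Ω A msq a l) s t| ≤ cC * Real.exp (-(δ * (HiggsLattice.Site.tdist s.1 t.1 : ℝ))))
    {s : HiggsLattice.Site P l × Ix N} (hs : s.1 ∈ levelSet l Ω) {q : HiggsLattice.Site P 0 × Ix N} (hq : good q.1) :
    ∑ t : HiggsLattice.Site P l × Ix N, |mat (fluctCovA C Ω A msq a l) s t| *
        |mat (avgQkLin C A l ∘ₗ propagatorK C Ω A msq a l) t q|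
      ≤ ∑ t : HiggsLattice.Site P l × Ix N, cC * Real.exp (-(δ * (HiggsLattice.Site.tdist s.1 t.1 : ℝ))) *
          ((((P.L : ℝ) ^ l) ^ P.d)⁻¹ *
            (cG * Real.exp δ * Real.exp (-(δ * (HiggsLattice.Site.tdist (blockIter l q.1) t.1 : ℝ))) * Real.sqrt N)) := by
  refine Finset.sum_le_sum fun t _ => ?_
  by_cases ht : t.1 ∈ levelSet l Ω
  · exact mul_le_mul (hC s t hs ht) (abs_mat_QG_le_R C Ω A msq a hl hcG hδ hG t hq) (abs_nonneg _) (by positivity)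
  · rw [mat_QG_eq_zero_R C Ω A msq a hmsq hak hΩ t ht (hgood _ hq), abs_zero, mul_zero]
    positivity

/-- **THE SANDWICH KERNEL ON A REGION (value)** at good points `x`, `x_q`: the same bound as on the torus.
[cite: Balaban1982Higgs1, (2.43) p.612, Prop. 2.1 (2.25) p.610, Prop. 2.3 (2.34) p.611] -/
theorem norm_sandwichR_cb_le (hl : l ≤ P.K) (hmsq : 0 < msq) (hak : 0 ≤ B1.aSeq a P.L l)
    (hΩ : ∀ x x' : HiggsLattice.Site P 0, blockIter l x = blockIter l x' → (x ∈ Ω ↔ x' ∈ Ω))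
    {good : HiggsLattice.Site P 0 → Prop} (hgood : ∀ x, good x → x ∈ Ω) {cG cC δ : ℝ} (hcG : 0 ≤ cG) (hcC : 0 ≤ cC) (hδ : 0 < δ)
    (hG : ∀ (g : ScalarField P 0 N) (M D : ℝ), (∀ x, ‖g x‖ ≤ M) → 0 ≤ D →
      ∀ x, good x → (∀ z, g z ≠ 0 → D ≤ (HiggsLattice.Site.tdist x z : ℝ)) →
        ‖propagatorK C Ω A msq a l g x‖ ≤ cG * Real.exp (-(δ * (D / (P.L : ℝ) ^ l))) * M)
    (hC : ∀ s t : HiggsLattice.Site P l × Ix N, s.1 ∈ levelSet l Ω → t.1 ∈ levelSet l Ω →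
      |mat (fluctCovA C Ω A msq a l) s t| ≤ cC * Real.exp (-(δ * (HiggsLattice.Site.tdist s.1 t.1 : ℝ))))
    {q : HiggsLattice.Site P 0 × Ix N} (hq : good q.1) {x : HiggsLattice.Site P 0} (hx : good x) :
    ‖sandwichR C Ω A msq a l (cb P N 0 q) x‖
      ≤ (cG * Real.exp δ * Real.sqrt N) ^ 2 * cC * (((P.L : ℝ) ^ l) ^ P.d)⁻¹ * profile P N (δ / 2) ^ 2 *
          Real.exp (δ / 2) * Real.exp (-(δ / 2 * ((HiggsLattice.Site.tdist x q.1 : ℝ) / (P.L : ℝ) ^ l))) := by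
  have h0 : sandwichR C Ω A msq a l (cb P N 0 q) = (propagatorK C Ω A msq a l ∘ₗ avgQkAdj C A l)
      (fluctCovA C Ω A msq a l (avgQkLin C A l (propagatorK C Ω A msq a l (cb P N 0 q)))) := by
    simp only [sandwichR, LinearMap.comp_apply]
  rw [h0]
  refine (norm_apply_le_sum_coord _ _ x).trans ?_
  have hK : 0 ≤ profile P N (δ / 2) := profile_nonneg' _ (by linarith)
  calc ∑ s : HiggsLattice.Site P l × Ix N, |fieldCoord (E N) (HiggsLattice.Site P l)
            (fluctCovA C Ω A msq a l (avgQkLin C A l (propagatorK C Ω A msq a l (cb P N 0 q)))) s| *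
          ‖(propagatorK C Ω A msq a l ∘ₗ avgQkAdj C A l) (cb P N l s) x‖
      ≤ ∑ s : HiggsLattice.Site P l × Ix N,
          (∑ t : HiggsLattice.Site P l × Ix N, cC * Real.exp (-(δ * (HiggsLattice.Site.tdist s.1 t.1 : ℝ))) *
            ((((P.L : ℝ) ^ l) ^ P.d)⁻¹ *
              (cG * Real.exp δ * Real.exp (-(δ * (HiggsLattice.Site.tdist (blockIter l q.1) t.1 : ℝ))) * Real.sqrt N))) *
          (cG * Real.exp δ * Real.exp (-(δ * (HiggsLattice.Site.tdist (blockIter l x) s.1 : ℝ))) * Real.sqrt N) := by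
        refine Finset.sum_le_sum fun s _ => ?_
        by_cases hs : s.1 ∈ levelSet l Ω
        · have h1 := (abs_coord_CQG_le_R C Ω A msq a s q).trans
            (sum_CQG_le_R C Ω A msq a hl hmsq hak hΩ hgood hcG hcC hδ.le hG hC hs hq)
          have h2 : ‖(propagatorK C Ω A msq a l ∘ₗ avgQkAdj C A l) (cb P N l s) x‖
              ≤ cG * Real.exp δ * Real.exp (-(δ * (HiggsLattice.Site.tdist (blockIter l x) s.1 : ℝ))) * Real.sqrt N := by
            rw [LinearMap.comp_apply]
            exact norm_G_avgQkAdj_cb_le_R C Ω A msq a hl hcG hδ.le hG s hx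
          exact mul_le_mul h1 h2 (norm_nonneg _) (Finset.sum_nonneg fun t _ => by positivity)
        · have hz : ‖(propagatorK C Ω A msq a l ∘ₗ avgQkAdj C A l) (cb P N l s) x‖ = 0 := by
            rw [LinearMap.comp_apply, G_avgQkAdj_cb_eq_zero C Ω A msq a hmsq hak hΩ s hs (hgood x hx), norm_zero]
          rw [hz, mul_zero]
          exact mul_nonneg (Finset.sum_nonneg fun t _ => by positivity) (by positivity)
    _ = (cG * Real.exp δ * Real.sqrt N) ^ 2 * cC * (((P.L : ℝ) ^ l) ^ P.d)⁻¹ *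
          ∑ s : HiggsLattice.Site P l × Ix N, ∑ t : HiggsLattice.Site P l × Ix N,
            Real.exp (-(δ * (HiggsLattice.Site.tdist (blockIter l x) s.1 : ℝ))) *
              Real.exp (-(δ * (HiggsLattice.Site.tdist s.1 t.1 : ℝ))) *
              Real.exp (-(δ * (HiggsLattice.Site.tdist (blockIter l q.1) t.1 : ℝ))) := by
        rw [Finset.mul_sum]
        refine Finset.sum_congr rfl fun s _ => ?_
        rw [Finset.sum_mul, Finset.mul_sum]
        refine Finset.sum_congr rfl fun t _ => ?_
        ring
    _ ≤ (cG * Real.exp δ * Real.sqrt N) ^ 2 * cC * (((P.L : ℝ) ^ l) ^ P.d)⁻¹ *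
          (profile P N (δ / 2) ^ 2 *
            Real.exp (-(δ / 2 * (HiggsLattice.Site.tdist (blockIter l x) (blockIter l q.1) : ℝ)))) :=
        mul_le_mul_of_nonneg_left (sum3_le hδ (blockIter l x) (blockIter l q.1) q.2) (by positivity)
    _ ≤ (cG * Real.exp δ * Real.sqrt N) ^ 2 * cC * (((P.L : ℝ) ^ l) ^ P.d)⁻¹ *
          (profile P N (δ / 2) ^ 2 * (Real.exp (δ / 2) *
            Real.exp (-(δ / 2 * ((HiggsLattice.Site.tdist x q.1 : ℝ) / (P.L : ℝ) ^ l))))) :=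
        mul_le_mul_of_nonneg_left (mul_le_mul_of_nonneg_left (exp_blockIter_le hl hδ.le x q.1) (pow_nonneg hK 2))
          (by positivity)
    _ = _ := by ring

/-- **THE SANDWICH KERNEL ON A REGION (covariant derivative)** at a bond with a good source point and a good `x_q`.
[cite: Balaban1982Higgs1, (2.43) p.612, Prop. 2.1 (2.25) p.610, Prop. 2.3 (2.34) p.611] -/
theorem norm_covDeriv_sandwichR_cb_le (hl : l ≤ P.K) (hmsq : 0 < msq) (hak : 0 ≤ B1.aSeq a P.L l)
    (hΩ : ∀ x x' : HiggsLattice.Site P 0, blockIter l x = blockIter l x' → (x ∈ Ω ↔ x' ∈ Ω))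
    {good : HiggsLattice.Site P 0 → Prop} (hgood : ∀ x, good x → x ∈ Ω)
    (hgood' : ∀ (x : HiggsLattice.Site P 0) (μ : Fin P.d), good x → x.shift μ ∈ Ω)
    {cG cD cC δ : ℝ} (hcG : 0 ≤ cG) (hcD : 0 ≤ cD) (hcC : 0 ≤ cC) (hδ : 0 < δ)
    (hG : ∀ (g : ScalarField P 0 N) (M D : ℝ), (∀ x, ‖g x‖ ≤ M) → 0 ≤ D →
      ∀ x, good x → (∀ z, g z ≠ 0 → D ≤ (HiggsLattice.Site.tdist x z : ℝ)) →
        ‖propagatorK C Ω A msq a l g x‖ ≤ cG * Real.exp (-(δ * (D / (P.L : ℝ) ^ l))) * M)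
    (hDG : ∀ (g : ScalarField P 0 N) (M D : ℝ), (∀ x, ‖g x‖ ≤ M) → 0 ≤ D →
      ∀ b : HiggsLattice.PBond P 0, good b.src → (∀ z, g z ≠ 0 → D ≤ (HiggsLattice.Site.tdist b.src z : ℝ)) →
        ‖covDeriv C A (propagatorK C Ω A msq a l g) b‖ ≤ cD * Real.exp (-(δ * (D / (P.L : ℝ) ^ l))) * M)
    (hC : ∀ s t : HiggsLattice.Site P l × Ix N, s.1 ∈ levelSet l Ω → t.1 ∈ levelSet l Ω →
      |mat (fluctCovA C Ω A msq a l) s t| ≤ cC * Real.exp (-(δ * (HiggsLattice.Site.tdist s.1 t.1 : ℝ))))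
    {q : HiggsLattice.Site P 0 × Ix N} (hq : good q.1) {b : HiggsLattice.PBond P 0} (hb : good b.src) :
    ‖covDeriv C A (sandwichR C Ω A msq a l (cb P N 0 q)) b‖
      ≤ (cD * Real.exp δ * Real.sqrt N) * (cG * Real.exp δ * Real.sqrt N) * cC * (((P.L : ℝ) ^ l) ^ P.d)⁻¹ *
          profile P N (δ / 2) ^ 2 * Real.exp (δ / 2) *
          Real.exp (-(δ / 2 * ((HiggsLattice.Site.tdist b.src q.1 : ℝ) / (P.L : ℝ) ^ l))) := by
  have h0 : sandwichR C Ω A msq a l (cb P N 0 q) = (propagatorK C Ω A msq a l ∘ₗ avgQkAdj C A l)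
      (fluctCovA C Ω A msq a l (avgQkLin C A l (propagatorK C Ω A msq a l (cb P N 0 q)))) := by
    simp only [sandwichR, LinearMap.comp_apply]
  rw [h0]
  refine (norm_covDeriv_apply_le_sum_coord C A _ _ b).trans ?_
  have hK : 0 ≤ profile P N (δ / 2) := profile_nonneg' _ (by linarith)
  calc ∑ s : HiggsLattice.Site P l × Ix N, |fieldCoord (E N) (HiggsLattice.Site P l)
            (fluctCovA C Ω A msq a l (avgQkLin C A l (propagatorK C Ω A msq a l (cb P N 0 q)))) s| *
          ‖covDeriv C A ((propagatorK C Ω A msq a l ∘ₗ avgQkAdj C A l) (cb P N l s)) b‖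
      ≤ ∑ s : HiggsLattice.Site P l × Ix N,
          (∑ t : HiggsLattice.Site P l × Ix N, cC * Real.exp (-(δ * (HiggsLattice.Site.tdist s.1 t.1 : ℝ))) *
            ((((P.L : ℝ) ^ l) ^ P.d)⁻¹ *
              (cG * Real.exp δ * Real.exp (-(δ * (HiggsLattice.Site.tdist (blockIter l q.1) t.1 : ℝ))) * Real.sqrt N))) *
          (cD * Real.exp δ * Real.exp (-(δ * (HiggsLattice.Site.tdist (blockIter l b.src) s.1 : ℝ))) * Real.sqrt N) := by
        refine Finset.sum_le_sum fun s _ => ?_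
        by_cases hs : s.1 ∈ levelSet l Ω
        · have h1 := (abs_coord_CQG_le_R C Ω A msq a s q).trans
            (sum_CQG_le_R C Ω A msq a hl hmsq hak hΩ hgood hcG hcC hδ.le hG hC hs hq)
          have h2 : ‖covDeriv C A ((propagatorK C Ω A msq a l ∘ₗ avgQkAdj C A l) (cb P N l s)) b‖
              ≤ cD * Real.exp δ * Real.exp (-(δ * (HiggsLattice.Site.tdist (blockIter l b.src) s.1 : ℝ))) * Real.sqrt N := by
            rw [LinearMap.comp_apply]
            exact norm_covDeriv_G_avgQkAdj_cb_le_R C Ω A msq a hl hcD hδ.le hDG s hb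
          exact mul_le_mul h1 h2 (norm_nonneg _) (Finset.sum_nonneg fun t _ => by positivity)
        · have hz : ‖covDeriv C A ((propagatorK C Ω A msq a l ∘ₗ avgQkAdj C A l) (cb P N l s)) b‖ = 0 := by
            have htgt : propagatorK C Ω A msq a l (avgQkAdj C A l (cb P N l s)) b.tgt = 0 :=
              G_avgQkAdj_cb_eq_zero C Ω A msq a hmsq hak hΩ s hs (hgood' b.src b.dir hb)
            rw [LinearMap.comp_apply, B1Cor23RegularRegion.covDeriv_eq,
              G_avgQkAdj_cb_eq_zero C Ω A msq a hmsq hak hΩ s hs (hgood _ hb), htgt]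
            simp
          rw [hz, mul_zero]
          exact mul_nonneg (Finset.sum_nonneg fun t _ => by positivity) (by positivity)
    _ = (cD * Real.exp δ * Real.sqrt N) * (cG * Real.exp δ * Real.sqrt N) * cC * (((P.L : ℝ) ^ l) ^ P.d)⁻¹ *
          ∑ s : HiggsLattice.Site P l × Ix N, ∑ t : HiggsLattice.Site P l × Ix N,
            Real.exp (-(δ * (HiggsLattice.Site.tdist (blockIter l b.src) s.1 : ℝ))) *
              Real.exp (-(δ * (HiggsLattice.Site.tdist s.1 t.1 : ℝ))) *
              Real.exp (-(δ * (HiggsLattice.Site.tdist (blockIter l q.1) t.1 : ℝ))) := by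
        rw [Finset.mul_sum]
        refine Finset.sum_congr rfl fun s _ => ?_
        rw [Finset.sum_mul, Finset.mul_sum]
        refine Finset.sum_congr rfl fun t _ => ?_
        ring
    _ ≤ (cD * Real.exp δ * Real.sqrt N) * (cG * Real.exp δ * Real.sqrt N) * cC * (((P.L : ℝ) ^ l) ^ P.d)⁻¹ *
          (profile P N (δ / 2) ^ 2 *
            Real.exp (-(δ / 2 * (HiggsLattice.Site.tdist (blockIter l b.src) (blockIter l q.1) : ℝ)))) :=
        mul_le_mul_of_nonneg_left (sum3_le hδ (blockIter l b.src) (blockIter l q.1) q.2) (by positivity)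
    _ ≤ (cD * Real.exp δ * Real.sqrt N) * (cG * Real.exp δ * Real.sqrt N) * cC * (((P.L : ℝ) ^ l) ^ P.d)⁻¹ *
          (profile P N (δ / 2) ^ 2 * (Real.exp (δ / 2) *
            Real.exp (-(δ / 2 * ((HiggsLattice.Site.tdist b.src q.1 : ℝ) / (P.L : ℝ) ^ l))))) :=
        mul_le_mul_of_nonneg_left (mul_le_mul_of_nonneg_left (exp_blockIter_le hl hδ.le b.src q.1) (pow_nonneg hK 2))
          (by positivity)
    _ = _ := by ring

end EngineR


/-! ## §1R The covariant scale pieces `G^η_{(j)}(Ω, A)` of (2.6) on a region and the identity (2.6) for regions -/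

section PiecesR

variable (C : ChargeData N) (Ω : Finset (HiggsLattice.Site P 0)) (A : HiggsLattice.VecField P 0) (msq a : ℝ)

/-- **The scale pieces of (2.6) on a region `Ω` at the background `B̃ = A`**: `G^η_{(0)} = G^ε_1(Ω,A) = C^{(0),ε}(Ω,A)`,
`G^η_{(j)} = a_j²(L^jε)^{−4}G^ε_j(Ω,A)Q_j^*C^{(j)}(Ω,A)Q_jG^ε_j(Ω,A)` for `1 ≤ j < k`, `0` beyond. [cite: Balaban1983Higgs3, (2.6) p.424] -/
def pieceR (k j : ℕ) : ScalarField P 0 N →ₗ[ℝ] ScalarField P 0 N :=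
  if j = 0 then propagatorK C Ω A msq a 1 else if j < k then (coeff221 P a j ^ 2) • sandwichR C Ω A msq a j else 0

variable {C Ω A msq a}

/-- `G^η_{(0)} = G^ε_1(Ω, A)`. [cite: Balaban1983Higgs3, (2.6) p.424] -/
theorem pieceR_zero (k : ℕ) : pieceR C Ω A msq a k 0 = propagatorK C Ω A msq a 1 := by simp [pieceR]

/-- `G^η_{(j)}` for `1 ≤ j < k`. [cite: Balaban1983Higgs3, (2.6) p.424] -/
theorem pieceR_of_pos {k j : ℕ} (hj1 : 1 ≤ j) (hjk : j < k) :
    pieceR C Ω A msq a k j = (coeff221 P a j ^ 2) • sandwichR C Ω A msq a j := by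
  unfold pieceR; rw [if_neg (by omega), if_pos hjk]

/-- no pieces beyond `j = k − 1`. [cite: Balaban1983Higgs3, (2.6) p.424] -/
theorem pieceR_of_le {k j : ℕ} (hj1 : 1 ≤ j) (hkj : k ≤ j) : pieceR C Ω A msq a k j = 0 := by
  unfold pieceR; rw [if_neg (by omega), if_neg (by omega)]

/-- **(2.6) on a region at the background `A`**: `Σ_{j=0}^{k−1} G^η_{(j)} = G^ε_k(Ω, A)` — (I.2.43) for regions
(`B1Eq243HiggsModel.display243_model`, m² > 0) with `G^ε_1(Ω, A) = C^{(0),ε}(Ω, A)` (`propagatorK_one`).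
[cite: Balaban1983Higgs3, (2.6) p.424] [cite: Balaban1982Higgs1, (2.43) p.612] -/
theorem sum_pieceR (hm : 0 < msq) (ha : 0 < a) (hL1 : 1 < P.L) {k : ℕ} (hk : 1 ≤ k) (hkK : k ≤ P.K) :
    ∑ j ∈ Finset.range k, pieceR C Ω A msq a k j = propagatorK C Ω A msq a k := by
  have hL : 1 < (P.L : ℝ) := by exact_mod_cast hL1
  obtain ⟨n, rfl⟩ : ∃ n, k = n + 1 := ⟨k - 1, by omega⟩
  rw [Finset.sum_range_succ', pieceR_zero, B1Eq243HiggsModel.display243_model C Ω A hm ha hL hk hkK,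
    B1Eq243HiggsModel.propagatorK_one C Ω A hL msq a, Finset.sum_Ico_eq_sum_range]
  congr 1
  refine Finset.sum_congr (by simp) fun i hi => ?_
  rw [pieceR_of_pos (by omega) (by have := Finset.mem_range.1 hi; omega), add_comm]
  rfl

end PiecesR

/-! ## §2R The pieces of (2.6) on a region in kernel form, bounded piece by piece at interior points -/

section PieceBoundsR

variable (C : ChargeData N) (Ω : Finset (HiggsLattice.Site P 0)) (A : HiggsLattice.VecField P 0) (msq : ℝ) {a : ℝ} {k j : ℕ}
  {good : HiggsLattice.Site P 0 → Prop}

/-- Rate weakening in a decay factor. [folklore] -/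
private theorem exp_rate_mono {ρ ρ' s : ℝ} (h : ρ' ≤ ρ) (hs : 0 ≤ s) : Real.exp (-(ρ * s)) ≤ Real.exp (-(ρ' * s)) :=
  Real.exp_le_exp.mpr (by nlinarith)

/-- scaling bookkeeping: `ε^{−d}·L^{−jd} = (L^jε)^{−d}`. [cite: Balaban1982Higgs1, (1.19) p.607] -/
private theorem inv_mesh_zero_pow_mul (j : ℕ) :
    (P.mesh 0 ^ P.d)⁻¹ * (((P.L : ℝ) ^ j) ^ P.d)⁻¹ = (P.mesh j ^ P.d)⁻¹ := by
  rw [mesh_eq_pow_mul P j, mul_pow, mul_inv, mul_comm]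

/-- scaling bookkeeping: `(L^jε)^{−n}(L^jε)^{n+m} = (L^jε)^m`. [cite: Balaban1982Higgs1, (1.19) p.607] -/
private theorem mesh_pow_cancel (j n m : ℕ) : (P.mesh j ^ n)⁻¹ * P.mesh j ^ (n + m) = P.mesh j ^ m := by
  rw [pow_add, inv_mul_cancel_left₀ (pow_ne_zero _ (P.mesh_pos j).ne')]

/-- **Piece `j = 0` (value)**: `ε^{−d}Σ_{i′}‖(G^ε_1e_{(x′,i′)})(x)‖ ≤ N√N·c₀L²·ε^{2}ε^{−d}·e^{−ρ|x − x′|/L}` from the (I.2.25) value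
clause at level `1` (`G^η_{(0)} = G^ε_1 = C^{(0)}`, source `e_{(x′,i′)}`: sup `≤ √N`, support `{x′}`).
[cite: Balaban1983Higgs3, (2.6) p.424, (2.10) p.426] [cite: Balaban1982Higgs1, Prop. 2.1 (2.25) p.610] -/
theorem absG_pieceR_zero_le {c₀ ρ : ℝ}
    (hG : ∀ (g : ScalarField P 0 N) (M D : ℝ), (∀ x, ‖g x‖ ≤ M) → 0 ≤ D →
      ∀ x, good x → (∀ z, g z ≠ 0 → D ≤ (HiggsLattice.Site.tdist x z : ℝ)) →
        ‖propagatorK C Ω A msq a 1 g x‖ ≤ c₀ * P.mesh 1 ^ 2 * Real.exp (-(ρ * (D / (P.L : ℝ) ^ 1))) * M)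
    {x : HiggsLattice.Site P 0} (hx : good x) (x' : HiggsLattice.Site P 0) :
    (P.mesh 0 ^ P.d)⁻¹ * ∑ i' : Ix N, ‖pieceR C Ω A msq a k 0 (cb P N 0 (x', i')) x‖
      ≤ ((N : ℝ) * Real.sqrt N * c₀ * (P.L : ℝ) ^ 2) * (P.mesh 0 ^ 2 * (P.mesh 0 ^ P.d)⁻¹) *
          Real.exp (-(ρ * ((HiggsLattice.Site.tdist x x' : ℝ) / (P.L : ℝ) ^ 1))) := by
  have h1 : ∀ i' : Ix N, ‖pieceR C Ω A msq a k 0 (cb P N 0 (x', i')) x‖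
      ≤ c₀ * P.mesh 1 ^ 2 * Real.exp (-(ρ * ((HiggsLattice.Site.tdist x x' : ℝ) / (P.L : ℝ) ^ 1))) * Real.sqrt N := by
    intro i'
    rw [pieceR_zero]
    exact hG (cb P N 0 (x', i')) (Real.sqrt N) (HiggsLattice.Site.tdist x x') (norm_cb_le _) (Nat.cast_nonneg _) x hx
      (fun z hz => by rw [eq_of_cb_ne_zero _ hz])
  have hsum : ∑ i' : Ix N, ‖pieceR C Ω A msq a k 0 (cb P N 0 (x', i')) x‖
      ≤ N * (c₀ * P.mesh 1 ^ 2 * Real.exp (-(ρ * ((HiggsLattice.Site.tdist x x' : ℝ) / (P.L : ℝ) ^ 1))) * Real.sqrt N) := by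
    refine (Finset.sum_le_sum fun i' _ => h1 i').trans ?_
    rw [Finset.sum_const, card_Ix, nsmul_eq_mul]
  refine (mul_le_mul_of_nonneg_left hsum (inv_nonneg.mpr (pow_nonneg (P.mesh_pos 0).le _))).trans (le_of_eq ?_)
  rw [mesh_eq_pow_mul P 1, pow_one]
  ring

/-- **Piece `j = 0` (covariant derivative)**: `ε^{−d}Σ_{i′}‖(D^ε_AG^ε_1e_{(x′,i′)})(⟨x,μ⟩)‖ ≤ N√N·c₀′L·ε·ε^{−d}·e^{−ρ|x − x′|/L}` from
the (I.2.25) derivative clause at level `1`. [cite: Balaban1983Higgs3, (2.6) p.424, (2.10) p.426]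
[cite: Balaban1982Higgs1, Prop. 2.1 (2.25) p.610] -/
theorem absDG_pieceR_zero_le {c₀' ρ : ℝ}
    (hDG : ∀ (g : ScalarField P 0 N) (M D : ℝ), (∀ x, ‖g x‖ ≤ M) → 0 ≤ D →
      ∀ b : HiggsLattice.PBond P 0, good b.src → (∀ z, g z ≠ 0 → D ≤ (HiggsLattice.Site.tdist b.src z : ℝ)) →
        ‖covDeriv C A (propagatorK C Ω A msq a 1 g) b‖
          ≤ c₀' * P.mesh 1 * Real.exp (-(ρ * (D / (P.L : ℝ) ^ 1))) * M)
    (μ : Fin P.d) {x : HiggsLattice.Site P 0} (hx : good x) (x' : HiggsLattice.Site P 0) :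
    (P.mesh 0 ^ P.d)⁻¹ * ∑ i' : Ix N, ‖covDeriv C A (pieceR C Ω A msq a k 0 (cb P N 0 (x', i'))) ⟨x, μ⟩‖
      ≤ ((N : ℝ) * Real.sqrt N * c₀' * (P.L : ℝ)) * (P.mesh 0 * (P.mesh 0 ^ P.d)⁻¹) *
          Real.exp (-(ρ * ((HiggsLattice.Site.tdist x x' : ℝ) / (P.L : ℝ) ^ 1))) := by
  have h1 : ∀ i' : Ix N, ‖covDeriv C A (pieceR C Ω A msq a k 0 (cb P N 0 (x', i'))) ⟨x, μ⟩‖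
      ≤ c₀' * P.mesh 1 * Real.exp (-(ρ * ((HiggsLattice.Site.tdist x x' : ℝ) / (P.L : ℝ) ^ 1))) * Real.sqrt N := by
    intro i'
    rw [pieceR_zero]
    exact hDG (cb P N 0 (x', i')) (Real.sqrt N) (HiggsLattice.Site.tdist x x') (norm_cb_le _) (Nat.cast_nonneg _) ⟨x, μ⟩ hx
      (fun z hz => by rw [eq_of_cb_ne_zero _ hz])
  have hsum : ∑ i' : Ix N, ‖covDeriv C A (pieceR C Ω A msq a k 0 (cb P N 0 (x', i'))) ⟨x, μ⟩‖
      ≤ N * (c₀' * P.mesh 1 * Real.exp (-(ρ * ((HiggsLattice.Site.tdist x x' : ℝ) / (P.L : ℝ) ^ 1))) * Real.sqrt N) := by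
    refine (Finset.sum_le_sum fun i' _ => h1 i').trans ?_
    rw [Finset.sum_const, card_Ix, nsmul_eq_mul]
  refine (mul_le_mul_of_nonneg_left hsum (inv_nonneg.mpr (pow_nonneg (P.mesh_pos 0).le _))).trans (le_of_eq ?_)
  rw [mesh_eq_pow_mul P 1, pow_one]
  ring

/-- **Piece `1 ≤ j < k` (value)**: `ε^{−d}Σ_{i′}‖(G^η_{(j)}e_{(x′,i′)})(x)‖ ≤ N²a²c₀²c₁·e^{2δ}e^{δ/2}K(δ/2)² · (L^jε)²(L^jε)^{−d} ·
e^{−(δ/2)|x − x′|/L^j}` — the scaling `ε^{−d}·a_j²(L^jε)^{−4}·(L^jε)^{2+2+2}·L^{−jd} = a_j²(L^jε)^{2−d}` of the print's «rescaling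
from the η-lattice to the L^{−j}-lattice». [cite: Balaban1983Higgs3, (2.6) p.424, (2.10) p.426]
[cite: Balaban1982Higgs1, (2.43) p.612] -/
theorem absG_pieceR_pos_le (ha : 0 < a) (hL1 : 1 < P.L) (hj1 : 1 ≤ j) (hjk : j < k) (hjK : j ≤ P.K) (hmsq : 0 < msq)
    (hΩ : ∀ x x' : HiggsLattice.Site P 0, blockIter j x = blockIter j x' → (x ∈ Ω ↔ x' ∈ Ω)) (hgood : ∀ x, good x → x ∈ Ω)
    {c₀ c₁ δ : ℝ} (hc₀ : 0 ≤ c₀) (hc₁ : 0 ≤ c₁) (hδ : 0 < δ)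
    (hG : ∀ (g : ScalarField P 0 N) (M D : ℝ), (∀ x, ‖g x‖ ≤ M) → 0 ≤ D →
      ∀ x, good x → (∀ z, g z ≠ 0 → D ≤ (HiggsLattice.Site.tdist x z : ℝ)) →
        ‖propagatorK C Ω A msq a j g x‖ ≤ c₀ * P.mesh j ^ 2 * Real.exp (-(δ * (D / (P.L : ℝ) ^ j))) * M)
    (hC : ∀ s t : HiggsLattice.Site P j × Ix N, s.1 ∈ levelSet j Ω → t.1 ∈ levelSet j Ω →
      |mat (fluctCovA C Ω A msq a j) s t| ≤ c₁ * P.mesh j ^ 2 * Real.exp (-(δ * (HiggsLattice.Site.tdist s.1 t.1 : ℝ))))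
    {x x' : HiggsLattice.Site P 0} (hx : good x) (hx' : good x') :
    (P.mesh 0 ^ P.d)⁻¹ * ∑ i' : Ix N, ‖pieceR C Ω A msq a k j (cb P N 0 (x', i')) x‖
      ≤ ((N : ℝ) ^ 2 * a ^ 2 * c₀ ^ 2 * c₁ * (Real.exp δ ^ 2 * Real.exp (δ / 2) * profile P N (δ / 2) ^ 2)) *
        (P.mesh j ^ 2 * (P.mesh j ^ P.d)⁻¹) *
          Real.exp (-(δ / 2 * ((HiggsLattice.Site.tdist x x' : ℝ) / (P.L : ℝ) ^ j))) := by
  set X := Real.exp (-(δ / 2 * ((HiggsLattice.Site.tdist x x' : ℝ) / (P.L : ℝ) ^ j))) with hX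
  have hm0 : 0 < P.mesh 0 := P.mesh_pos 0
  have hmj : 0 < P.mesh j := P.mesh_pos j
  have hLj : (0 : ℝ) < (P.L : ℝ) ^ j := pow_pos (by exact_mod_cast P.hL) j
  have hsw : ∀ i' : Ix N, ‖pieceR C Ω A msq a k j (cb P N 0 (x', i')) x‖
      ≤ coeff221 P a j ^ 2 * ((c₀ * P.mesh j ^ 2 * Real.exp δ * Real.sqrt N) ^ 2 * (c₁ * P.mesh j ^ 2) *
          (((P.L : ℝ) ^ j) ^ P.d)⁻¹ * profile P N (δ / 2) ^ 2 * Real.exp (δ / 2) * X) := by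
    intro i'
    rw [pieceR_of_pos hj1 hjk, LinearMap.smul_apply, Pi.smul_apply, norm_smul, Real.norm_eq_abs,
      abs_of_nonneg (sq_nonneg _)]
    exact mul_le_mul_of_nonneg_left
      (norm_sandwichR_cb_le C Ω A msq a hjK hmsq (B1.aSeq_pos ha (by exact_mod_cast hL1) hj1).le hΩ hgood (by positivity)
        (by positivity) hδ hG hC (q := (x', i')) hx' hx) (sq_nonneg _)
  have hsum : ∑ i' : Ix N, ‖pieceR C Ω A msq a k j (cb P N 0 (x', i')) x‖
      ≤ N * (coeff221 P a j ^ 2 * ((c₀ * P.mesh j ^ 2 * Real.exp δ * Real.sqrt N) ^ 2 * (c₁ * P.mesh j ^ 2) *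
          (((P.L : ℝ) ^ j) ^ P.d)⁻¹ * profile P N (δ / 2) ^ 2 * Real.exp (δ / 2) * X)) := by
    refine (Finset.sum_le_sum fun i' _ => hsw i').trans ?_
    rw [Finset.sum_const, card_Ix, nsmul_eq_mul]
  refine (mul_le_mul_of_nonneg_left hsum (inv_nonneg.mpr (pow_nonneg hm0.le _))).trans ?_
  have hsq : (c₀ * P.mesh j ^ 2 * Real.exp δ * Real.sqrt N) ^ 2 = (c₀ * P.mesh j ^ 2 * Real.exp δ) ^ 2 * N := by
    rw [mul_pow (c₀ * P.mesh j ^ 2 * Real.exp δ), Real.sq_sqrt (Nat.cast_nonneg _)]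
  -- the scaling identity
  have hid : (P.mesh 0 ^ P.d)⁻¹ * (N * (B1.aSeq a (P.L : ℝ) j ^ 2 * (P.mesh j ^ 4)⁻¹ *
        ((c₀ * P.mesh j ^ 2 * Real.exp δ) ^ 2 * N * (c₁ * P.mesh j ^ 2) *
          (((P.L : ℝ) ^ j) ^ P.d)⁻¹ * profile P N (δ / 2) ^ 2 * Real.exp (δ / 2) * X)))
      = B1.aSeq a (P.L : ℝ) j ^ 2 * (((N : ℝ) ^ 2 * c₀ ^ 2 * c₁ *
          (Real.exp δ ^ 2 * Real.exp (δ / 2) * profile P N (δ / 2) ^ 2)) * (P.mesh j ^ 2 * (P.mesh j ^ P.d)⁻¹) * X) := by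
    calc (P.mesh 0 ^ P.d)⁻¹ * (N * (B1.aSeq a (P.L : ℝ) j ^ 2 * (P.mesh j ^ 4)⁻¹ *
          ((c₀ * P.mesh j ^ 2 * Real.exp δ) ^ 2 * N * (c₁ * P.mesh j ^ 2) *
            (((P.L : ℝ) ^ j) ^ P.d)⁻¹ * profile P N (δ / 2) ^ 2 * Real.exp (δ / 2) * X)))
        = B1.aSeq a (P.L : ℝ) j ^ 2 * (((N : ℝ) ^ 2 * c₀ ^ 2 * c₁ *
            (Real.exp δ ^ 2 * Real.exp (δ / 2) * profile P N (δ / 2) ^ 2)) * X) *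
            ((P.mesh 0 ^ P.d)⁻¹ * (((P.L : ℝ) ^ j) ^ P.d)⁻¹) * ((P.mesh j ^ 4)⁻¹ * P.mesh j ^ (4 + 2)) := by ring
      _ = _ := by rw [inv_mesh_zero_pow_mul, mesh_pow_cancel]; ring
  rw [hsq, B1Eq243HiggsModel.coeff221_sq, hid]
  have hrest : 0 ≤ ((N : ℝ) ^ 2 * c₀ ^ 2 * c₁ * (Real.exp δ ^ 2 * Real.exp (δ / 2) * profile P N (δ / 2) ^ 2)) *
      (P.mesh j ^ 2 * (P.mesh j ^ P.d)⁻¹) * X := by positivity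
  calc B1.aSeq a (P.L : ℝ) j ^ 2 * (((N : ℝ) ^ 2 * c₀ ^ 2 * c₁ *
          (Real.exp δ ^ 2 * Real.exp (δ / 2) * profile P N (δ / 2) ^ 2)) * (P.mesh j ^ 2 * (P.mesh j ^ P.d)⁻¹) * X)
      ≤ a ^ 2 * (((N : ℝ) ^ 2 * c₀ ^ 2 * c₁ *
          (Real.exp δ ^ 2 * Real.exp (δ / 2) * profile P N (δ / 2) ^ 2)) * (P.mesh j ^ 2 * (P.mesh j ^ P.d)⁻¹) * X) :=
        mul_le_mul_of_nonneg_right (aSeq_sq_le ha hL1 hj1) hrest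
    _ = _ := by ring

/-- **Piece `1 ≤ j < k` (covariant derivative)**: the same with the (I.2.25) derivative clause on the first factor, one power of
`L^jε` less. [cite: Balaban1983Higgs3, (2.6) p.424, (2.10) p.426] [cite: Balaban1982Higgs1, (2.43) p.612] -/
theorem absDG_pieceR_pos_le (ha : 0 < a) (hL1 : 1 < P.L) (hj1 : 1 ≤ j) (hjk : j < k) (hjK : j ≤ P.K) (hmsq : 0 < msq)
    (hΩ : ∀ x x' : HiggsLattice.Site P 0, blockIter j x = blockIter j x' → (x ∈ Ω ↔ x' ∈ Ω)) (hgood : ∀ x, good x → x ∈ Ω)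
    (hgood' : ∀ (x : HiggsLattice.Site P 0) (μ : Fin P.d), good x → x.shift μ ∈ Ω)
    {c₀ c₀' c₁ δ : ℝ} (hc₀ : 0 ≤ c₀) (hc₀' : 0 ≤ c₀') (hc₁ : 0 ≤ c₁) (hδ : 0 < δ)
    (hG : ∀ (g : ScalarField P 0 N) (M D : ℝ), (∀ x, ‖g x‖ ≤ M) → 0 ≤ D →
      ∀ x, good x → (∀ z, g z ≠ 0 → D ≤ (HiggsLattice.Site.tdist x z : ℝ)) →
        ‖propagatorK C Ω A msq a j g x‖ ≤ c₀ * P.mesh j ^ 2 * Real.exp (-(δ * (D / (P.L : ℝ) ^ j))) * M)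
    (hDG : ∀ (g : ScalarField P 0 N) (M D : ℝ), (∀ x, ‖g x‖ ≤ M) → 0 ≤ D →
      ∀ b : HiggsLattice.PBond P 0, good b.src → (∀ z, g z ≠ 0 → D ≤ (HiggsLattice.Site.tdist b.src z : ℝ)) →
        ‖covDeriv C A (propagatorK C Ω A msq a j g) b‖
          ≤ c₀' * P.mesh j * Real.exp (-(δ * (D / (P.L : ℝ) ^ j))) * M)
    (hC : ∀ s t : HiggsLattice.Site P j × Ix N, s.1 ∈ levelSet j Ω → t.1 ∈ levelSet j Ω →
      |mat (fluctCovA C Ω A msq a j) s t| ≤ c₁ * P.mesh j ^ 2 * Real.exp (-(δ * (HiggsLattice.Site.tdist s.1 t.1 : ℝ))))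
    (μ : Fin P.d) {x x' : HiggsLattice.Site P 0} (hx : good x) (hx' : good x') :
    (P.mesh 0 ^ P.d)⁻¹ * ∑ i' : Ix N, ‖covDeriv C A (pieceR C Ω A msq a k j (cb P N 0 (x', i'))) ⟨x, μ⟩‖
      ≤ ((N : ℝ) ^ 2 * a ^ 2 * (c₀' * c₀) * c₁ * (Real.exp δ ^ 2 * Real.exp (δ / 2) * profile P N (δ / 2) ^ 2)) *
        (P.mesh j * (P.mesh j ^ P.d)⁻¹) *
          Real.exp (-(δ / 2 * ((HiggsLattice.Site.tdist x x' : ℝ) / (P.L : ℝ) ^ j))) := by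
  set X := Real.exp (-(δ / 2 * ((HiggsLattice.Site.tdist x x' : ℝ) / (P.L : ℝ) ^ j))) with hX
  have hm0 : 0 < P.mesh 0 := P.mesh_pos 0
  have hmj : 0 < P.mesh j := P.mesh_pos j
  have hLj : (0 : ℝ) < (P.L : ℝ) ^ j := pow_pos (by exact_mod_cast P.hL) j
  have hsw : ∀ i' : Ix N, ‖covDeriv C A (pieceR C Ω A msq a k j (cb P N 0 (x', i'))) ⟨x, μ⟩‖
      ≤ coeff221 P a j ^ 2 * ((c₀' * P.mesh j * Real.exp δ * Real.sqrt N) * (c₀ * P.mesh j ^ 2 * Real.exp δ * Real.sqrt N) *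
          (c₁ * P.mesh j ^ 2) * (((P.L : ℝ) ^ j) ^ P.d)⁻¹ * profile P N (δ / 2) ^ 2 * Real.exp (δ / 2) * X) := by
    intro i'
    rw [pieceR_of_pos hj1 hjk, LinearMap.smul_apply, covDeriv_smul'', norm_smul, Real.norm_eq_abs,
      abs_of_nonneg (sq_nonneg _)]
    exact mul_le_mul_of_nonneg_left
      (norm_covDeriv_sandwichR_cb_le C Ω A msq a hjK hmsq (B1.aSeq_pos ha (by exact_mod_cast hL1) hj1).le hΩ hgood hgood'
        (by positivity) (by positivity) (by positivity) hδ hG hDG hC (q := (x', i')) hx' (b := ⟨x, μ⟩) hx)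
      (sq_nonneg _)
  have hsum : ∑ i' : Ix N, ‖covDeriv C A (pieceR C Ω A msq a k j (cb P N 0 (x', i'))) ⟨x, μ⟩‖
      ≤ N * (coeff221 P a j ^ 2 * ((c₀' * P.mesh j * Real.exp δ * Real.sqrt N) *
          (c₀ * P.mesh j ^ 2 * Real.exp δ * Real.sqrt N) *
          (c₁ * P.mesh j ^ 2) * (((P.L : ℝ) ^ j) ^ P.d)⁻¹ * profile P N (δ / 2) ^ 2 * Real.exp (δ / 2) * X)) := by
    refine (Finset.sum_le_sum fun i' _ => hsw i').trans ?_
    rw [Finset.sum_const, card_Ix, nsmul_eq_mul]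
  refine (mul_le_mul_of_nonneg_left hsum (inv_nonneg.mpr (pow_nonneg hm0.le _))).trans ?_
  rw [B1Eq243HiggsModel.coeff221_sq]
  have hre : (c₀' * P.mesh j * Real.exp δ * Real.sqrt N) * (c₀ * P.mesh j ^ 2 * Real.exp δ * Real.sqrt N)
      = c₀' * c₀ * P.mesh j ^ 3 * Real.exp δ ^ 2 * N := by
    have h := Real.mul_self_sqrt (Nat.cast_nonneg N : (0 : ℝ) ≤ N)
    calc (c₀' * P.mesh j * Real.exp δ * Real.sqrt N) * (c₀ * P.mesh j ^ 2 * Real.exp δ * Real.sqrt N)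
        = c₀' * c₀ * P.mesh j ^ 3 * Real.exp δ ^ 2 * (Real.sqrt N * Real.sqrt N) := by ring
      _ = _ := by rw [h]
  rw [hre]
  have hid : (P.mesh 0 ^ P.d)⁻¹ * (N * (B1.aSeq a (P.L : ℝ) j ^ 2 * (P.mesh j ^ 4)⁻¹ *
        (c₀' * c₀ * P.mesh j ^ 3 * Real.exp δ ^ 2 * N * (c₁ * P.mesh j ^ 2) *
          (((P.L : ℝ) ^ j) ^ P.d)⁻¹ * profile P N (δ / 2) ^ 2 * Real.exp (δ / 2) * X)))
      = B1.aSeq a (P.L : ℝ) j ^ 2 * (((N : ℝ) ^ 2 * (c₀' * c₀) * c₁ *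
          (Real.exp δ ^ 2 * Real.exp (δ / 2) * profile P N (δ / 2) ^ 2)) * (P.mesh j * (P.mesh j ^ P.d)⁻¹) * X) := by
    calc (P.mesh 0 ^ P.d)⁻¹ * (N * (B1.aSeq a (P.L : ℝ) j ^ 2 * (P.mesh j ^ 4)⁻¹ *
          (c₀' * c₀ * P.mesh j ^ 3 * Real.exp δ ^ 2 * N * (c₁ * P.mesh j ^ 2) *
            (((P.L : ℝ) ^ j) ^ P.d)⁻¹ * profile P N (δ / 2) ^ 2 * Real.exp (δ / 2) * X)))
        = B1.aSeq a (P.L : ℝ) j ^ 2 * (((N : ℝ) ^ 2 * (c₀' * c₀) * c₁ *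
            (Real.exp δ ^ 2 * Real.exp (δ / 2) * profile P N (δ / 2) ^ 2)) * X) *
            ((P.mesh 0 ^ P.d)⁻¹ * (((P.L : ℝ) ^ j) ^ P.d)⁻¹) * ((P.mesh j ^ 4)⁻¹ * P.mesh j ^ (4 + 1)) := by ring
      _ = _ := by rw [inv_mesh_zero_pow_mul, mesh_pow_cancel, pow_one]; ring
  rw [hid]
  have hrest : 0 ≤ ((N : ℝ) ^ 2 * (c₀' * c₀) * c₁ * (Real.exp δ ^ 2 * Real.exp (δ / 2) * profile P N (δ / 2) ^ 2)) *
      (P.mesh j * (P.mesh j ^ P.d)⁻¹) * X := by positivity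
  calc B1.aSeq a (P.L : ℝ) j ^ 2 * (((N : ℝ) ^ 2 * (c₀' * c₀) * c₁ *
          (Real.exp δ ^ 2 * Real.exp (δ / 2) * profile P N (δ / 2) ^ 2)) * (P.mesh j * (P.mesh j ^ P.d)⁻¹) * X)
      ≤ a ^ 2 * (((N : ℝ) ^ 2 * (c₀' * c₀) * c₁ *
          (Real.exp δ ^ 2 * Real.exp (δ / 2) * profile P N (δ / 2) ^ 2)) * (P.mesh j * (P.mesh j ^ P.d)⁻¹) * X) :=
        mul_le_mul_of_nonneg_right (aSeq_sq_le ha hL1 hj1) hrest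
    _ = _ := by ring

/-- **Pieces `j ≥ k`, `j ≥ 1` vanish** (no such terms in (2.6)). [cite: Balaban1983Higgs3, (2.6) p.424] -/
theorem absG_pieceR_ge_eq_zero (hj1 : 1 ≤ j) (hkj : k ≤ j) (x x' : HiggsLattice.Site P 0) :
    (P.mesh 0 ^ P.d)⁻¹ * ∑ i' : Ix N, ‖pieceR C Ω A msq a k j (cb P N 0 (x', i')) x‖ = 0 := by
  simp [pieceR_of_le hj1 hkj]

/-- **Pieces `j ≥ k`, `j ≥ 1` vanish**, derivative. [cite: Balaban1983Higgs3, (2.6) p.424] -/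
theorem absDG_pieceR_ge_eq_zero (hj1 : 1 ≤ j) (hkj : k ≤ j) (μ : Fin P.d) (x x' : HiggsLattice.Site P 0) :
    (P.mesh 0 ^ P.d)⁻¹ * ∑ i' : Ix N, ‖covDeriv C A (pieceR C Ω A msq a k j (cb P N 0 (x', i'))) ⟨x, μ⟩‖ = 0 := by
  simp [pieceR_of_le hj1 hkj, covDeriv_zero'']

/-- **The regularity hypothesis of (I.2.25) in p35's (2.23)-form, from `δ_A`-regularity and the smallness `L^kδ_A|e| ≤ T ≤ e₁`**
(at every level `l ≤ k` with `L^lε ≤ 1`; `β = 1`, `c_reg = 1`, `e_c = e₁`). [cite: Balaban1982Higgs1, (2.23) p.610] -/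
theorem reg223R_of_small {l : ℕ} (hlk : l ≤ k) (hmesh : P.mesh l ≤ 1) {ec δA T : ℝ} (hec : 0 < ec) (hδA : 0 ≤ δA)
    (hreg : ∀ z ∈ Ω, ∀ (μ ν : Fin P.d), |A ⟨z.shift ν, μ⟩ - A ⟨z, μ⟩| ≤ δA)
    (ht : (P.L : ℝ) ^ k * δA * |C.e| ≤ T) (hT : T ≤ ec) :
    ∀ x ∈ Ω, ∀ (μ ν : Fin P.d),
      P.mesh l * |C.e| / ec * |A ⟨x.shift μ, ν⟩ - A ⟨x, ν⟩| ≤ 1 * ec ^ ((1 : ℝ) - 1) / (P.L : ℝ) ^ l := by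
  intro x hxΩ μ ν
  have hLl : (0 : ℝ) < (P.L : ℝ) ^ l := pow_pos (by exact_mod_cast P.hL) l
  have hL1 : (1 : ℝ) ≤ P.L := by exact_mod_cast P.hL
  have hA := hreg x hxΩ ν μ
  have he : 0 ≤ |C.e| := abs_nonneg _
  have hpow : (P.L : ℝ) ^ l ≤ (P.L : ℝ) ^ k := pow_le_pow_right₀ hL1 hlk
  rw [sub_self, Real.rpow_zero, one_mul, div_mul_eq_mul_div, div_le_div_iff₀ hec hLl, one_mul]
  have h₂ : P.mesh l * |C.e| ≤ 1 * |C.e| := mul_le_mul_of_nonneg_right hmesh he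
  have h₁ : P.mesh l * |C.e| * |A ⟨x.shift μ, ν⟩ - A ⟨x, ν⟩| ≤ 1 * |C.e| * δA :=
    mul_le_mul h₂ hA (abs_nonneg _) (by positivity)
  calc P.mesh l * |C.e| * |A ⟨x.shift μ, ν⟩ - A ⟨x, ν⟩| * (P.L : ℝ) ^ l
      ≤ 1 * |C.e| * δA * (P.L : ℝ) ^ k := mul_le_mul h₁ hpow hLl.le (by positivity)
    _ = (P.L : ℝ) ^ k * δA * |C.e| := by ring
    _ ≤ ec := ht.trans hT

end PieceBoundsR

/-! ## §3R Interior points, the carrier on them, and (2.10) PROVED for regions -/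

section CarrierR

open B1TorusCubeLocality26 (rS)
open B1TorusRegionRop (chi)
open B1Ineq234LevelZero (tdist_shift_le_one)
open B1Ineq234Concrete (tdist_self)
open B2Eq337ScalarIntegration (Regions)
open B2Eq328ConcretePieces (pieceF inPiece)
open B3Ineq210RegularTorus (cst210 cst210_pos le_cst210_zero le_cst210_zero' le_cst210_pos le_cst210_pos')

variable {k K₀ : ℕ} {Ω : Finset (HiggsLattice.Site P 0)}

/-- **Interior points of `Ω` at scale `k` with cubes of `K₀` blocks**: the sites whose lattice ball of radius
`2r_S + 2L^kK₀(d+1) + 1` lies in `Ω` — the `R₀`-restriction «dist({x,x′}, Ωᶜ) ≥ R₀» of Proposition I.2.1 in the tree's constants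
(p35's margin for (I.2.25) on regions). [cite: Balaban1982Higgs1, Prop. 2.1 p.610] [cite: Balaban1983RegularityDecay, Theorem p.573] -/
def Interior (k K₀ : ℕ) (Ω : Finset (HiggsLattice.Site P 0)) (x : HiggsLattice.Site P 0) : Prop :=
  ∀ y, HiggsLattice.Site.tdist x y ≤ 2 * rS P k K₀ + 2 * half P k K₀ * (P.d + 1) + 1 → y ∈ Ω

/-- `half` is monotone in the level. [cite: Balaban1982Higgs1, (1.19) p.607] -/
theorem half_mono {l : ℕ} (hl : l ≤ k) : half P l K₀ ≤ half P k K₀ := by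
  unfold half
  exact Nat.mul_le_mul_right _ (Nat.pow_le_pow_right P.hL hl)

/-- `r_S` is monotone in the level. [cite: Balaban1982Higgs1, (2.26) p.610] -/
theorem rS_mono {l : ℕ} (hl : l ≤ k) : rS P l K₀ ≤ rS P k K₀ := by
  unfold rS
  exact Nat.add_le_add (Nat.div_le_div_right (Nat.mul_le_mul_left _ (half_mono hl))) (Nat.pow_le_pow_right P.hL hl)

/-- An interior point at scale `k` has the value margin of every level `l ≤ k`. [cite: Balaban1982Higgs1, Prop. 2.1 p.610] -/
theorem Interior.margin {l : ℕ} (hl : l ≤ k) {x : HiggsLattice.Site P 0} (hx : Interior k K₀ Ω x) :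
    ∀ y, HiggsLattice.Site.tdist x y ≤ 2 * rS P l K₀ + 2 * half P l K₀ * (P.d + 1) → y ∈ Ω := by
  intro y hy
  apply hx
  have h1 := rS_mono (P := P) (K₀ := K₀) hl
  have h2 := half_mono (P := P) (K₀ := K₀) hl
  have h3 : 2 * half P l K₀ * (P.d + 1) ≤ 2 * half P k K₀ * (P.d + 1) := Nat.mul_le_mul_right _ (Nat.mul_le_mul_left _ h2)
  omega

/-- An interior point at scale `k` has the derivative margin of every level `l ≤ k`. [cite: Balaban1982Higgs1, Prop. 2.1 p.610] -/
theorem Interior.margin' {l : ℕ} (hl : l ≤ k) {x : HiggsLattice.Site P 0} (hx : Interior k K₀ Ω x) :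
    ∀ y, HiggsLattice.Site.tdist x y ≤ 2 * rS P l K₀ + 2 * half P l K₀ * (P.d + 1) + 1 → y ∈ Ω := by
  intro y hy
  apply hx
  have h1 := rS_mono (P := P) (K₀ := K₀) hl
  have h2 := half_mono (P := P) (K₀ := K₀) hl
  have h3 : 2 * half P l K₀ * (P.d + 1) ≤ 2 * half P k K₀ * (P.d + 1) := Nat.mul_le_mul_right _ (Nat.mul_le_mul_left _ h2)
  omega

/-- An interior point lies in `Ω`. [cite: Balaban1982Higgs1, Prop. 2.1 p.610] -/
theorem Interior.mem {x : HiggsLattice.Site P 0} (hx : Interior k K₀ Ω x) : x ∈ Ω :=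
  hx x (by rw [tdist_self]; exact Nat.zero_le _)

/-- The neighbours of an interior point lie in `Ω`. [cite: Balaban1982Higgs1, Prop. 2.1 p.610] -/
theorem Interior.shift_mem {x : HiggsLattice.Site P 0} (hx : Interior k K₀ Ω x) (μ : Fin P.d) : x.shift μ ∈ Ω :=
  hx _ ((tdist_shift_le_one x μ).trans (by omega))

/-- `1_Ω·g` in p35's notation is the cut. [cite: Balaban1982Higgs2, (2.56) p.570] -/
theorem chi_smul_eq_cutTo (g : ScalarField P 0 N) : chi Ω • g = cutTo Ω g := by
  funext x
  by_cases hx : x ∈ Ω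
  · rw [cutTo_of_mem _ _ hx, Pi.smul_apply', chi, if_pos hx, one_smul]
  · rw [cutTo_of_not_mem _ _ hx, Pi.smul_apply', chi, if_neg hx, zero_smul]

/-- For `x ∈ Ω` (a union of `l`-fold blocks): `(G^ε_l(Ω)g)(x) = (G^ε_l(Ω)(1_Ωg))(x)`. [cite: Balaban1982Higgs1, (2.20) p.610] -/
theorem propagatorK_apply_eq_chi (C : ChargeData N) (A : HiggsLattice.VecField P 0) {msq a : ℝ} {l : ℕ} (hmsq : 0 < msq)
    (hak : 0 ≤ B1.aSeq a P.L l) (hΩ : ∀ x x' : HiggsLattice.Site P 0, blockIter l x = blockIter l x' → (x ∈ Ω ↔ x' ∈ Ω))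
    (g : ScalarField P 0 N) {x : HiggsLattice.Site P 0} (hx : x ∈ Ω) :
    propagatorK C Ω A msq a l g x = propagatorK C Ω A msq a l (chi Ω • g) x := by
  rw [chi_smul_eq_cutTo, propagatorK_cutTo C A hmsq hak hΩ, cutTo_of_mem _ _ hx]

/-- The constant region tower `(∅; Ω^{(1)}, …, Ω^{(K′)})` feeding r14 g14's region form of (I.2.34). [cite: Balaban1982Higgs1, (2.32) p.611] -/
def towerR (Ω : Finset (HiggsLattice.Site P 0)) (K' : ℕ) : Regions P K' :=
  ⟨∅, fun j => levelSet (j.val + 1) Ω⟩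

/-- The tower's fine regions are all `Ω`. [cite: Balaban1982Higgs1, (2.32) p.611] -/
theorem pieceF_towerR {K' : ℕ} (j : Fin K')
    (hΩ : ∀ x x' : HiggsLattice.Site P 0, blockIter (j.val + 1) x = blockIter (j.val + 1) x' → (x ∈ Ω ↔ x' ∈ Ω)) :
    pieceF (towerR Ω K') j = Ω := by
  ext x
  rw [pieceF, Finset.mem_filter, inPiece]
  show x ∈ Finset.univ ∧ blockIter (j.val + 1) x ∈ levelSet (j.val + 1) Ω ↔ x ∈ Ω
  rw [← mem_iff_blockIter_mem hΩ]
  simp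

end CarrierR

/-- **The concrete carrier of B3 (2.10) on a REGION `Ω ⊊ T_η` at a regular non-constant background `B̃ = A`**: sites = the
INTERIOR points of `Ω` (`Interior k K₀ Ω`, realising the `R₀`-clause «dist({x,x′}, Ωᶜ) ≥ R₀» of Proposition I.2.1 with the tree's
margin `2r_S + 2L^kK₀(d+1) + 1` fine sites); `dist = ε|x − x′|`; `absG j x x′ = ε^{−d}Σ_{i′}‖(G^η_{(j)}(Ω,A)e_{(x′,i′)})(x)‖`, the kernel of the
piece `pieceR` of (2.6) for the region operators `G^ε_j(Ω,A)`, `C^{(j)}(Ω,A)` RESTRICTED to interior points (the operators are not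
modified); `absDG` its covariant derivative in the row variable; the fields of (2.5), (2.11), (2.12) are not modelled (`0`).
[cite: Balaban1983Higgs3, (2.6) p.424, (2.10) p.426] [cite: Balaban1982Higgs1, Prop. 2.1 p.610] -/
def regRegionKernels {P : HiggsLattice.Params} {N : ℕ} (hL1 : 1 < P.L) (C : ChargeData N) (Ω : Finset (HiggsLattice.Site P 0))
    (A : HiggsLattice.VecField P 0) (msq a : ℝ) (k K₀ : ℕ) : ScaledKernels where
  Site := {x : HiggsLattice.Site P 0 // Interior k K₀ Ω x}
  Bond := HiggsLattice.PBond P 0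
  Dir := Fin P.d
  LocFn := PUnit
  dist := fun x x' => P.mesh 0 * (HiggsLattice.Site.tdist x.1 x'.1 : ℝ)
  dist2 := fun _ _ _ => 0
  distBlock := fun _ _ _ => 0
  distSupp := fun _ _ => 0
  distΩ₂ := 0
  L := P.L
  η := P.mesh 0
  d := P.d
  eRun := 0
  pRun := 0
  one_lt_L := by exact_mod_cast hL1
  η_pos := P.mesh_pos 0
  absG := fun j x x' => (P.mesh 0 ^ P.d)⁻¹ * ∑ i' : Ix N, ‖pieceR C Ω A msq a k j (cb P N 0 (x'.1, i')) x.1‖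
  absDG := fun j μ x x' => (P.mesh 0 ^ P.d)⁻¹ * ∑ i' : Ix N, ‖covDeriv C A (pieceR C Ω A msq a k j (cb P N 0 (x'.1, i'))) ⟨x.1, μ⟩‖
  holderDiff := fun _ _ _ _ _ => 0
  absGavg := fun _ _ _ => 0
  normDeltaG := fun _ _ _ => 0
  norm116 := fun _ _ _ _ _ => 0

section CarrierR2

variable {hL1 : 1 < P.L} {C : ChargeData N} {Ω : Finset (HiggsLattice.Site P 0)} {A : HiggsLattice.VecField P 0} {msq a : ℝ}
  {k K₀ : ℕ}

/-- the carrier's `L^jη` is the model's `L^jε`. [cite: Balaban1983Higgs3, (2.10) p.426] -/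
theorem scaleR_eq (j : ℕ) : (regRegionKernels hL1 C Ω A msq a k K₀).scale j = P.mesh j := by
  show (P.L : ℝ) ^ j * P.mesh 0 = P.mesh j
  rw [mesh_eq_pow_mul P j]

/-- kernel: `(L^jη)^{2−d} = (L^jη)²·((L^jη)^d)^{−1}`. [folklore] -/
private theorem rpow_two_sub' (j : ℕ) : P.mesh j ^ ((2 : ℝ) - (P.d : ℝ)) = P.mesh j ^ 2 * (P.mesh j ^ P.d)⁻¹ := by
  rw [Real.rpow_sub (P.mesh_pos j), div_eq_mul_inv, Real.rpow_natCast _ P.d, Real.rpow_two]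

/-- kernel: `(L^jη)^{1−d} = (L^jη)·((L^jη)^d)^{−1}`. [folklore] -/
private theorem rpow_one_sub' (j : ℕ) : P.mesh j ^ ((1 : ℝ) - (P.d : ℝ)) = P.mesh j * (P.mesh j ^ P.d)⁻¹ := by
  rw [Real.rpow_sub (P.mesh_pos j), div_eq_mul_inv, Real.rpow_natCast _ P.d, Real.rpow_one]

/-- kernel: `(L^jη)^{−1}·(ε|x − x′|) = |x − x′|/L^j`. [folklore] -/
private theorem scale_inv_mul_dist' (j : ℕ) (x x' : HiggsLattice.Site P 0) :
    (P.mesh j)⁻¹ * (P.mesh 0 * (HiggsLattice.Site.tdist x x' : ℝ)) = (HiggsLattice.Site.tdist x x' : ℝ) / (P.L : ℝ) ^ j := by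
  rw [mesh_eq_pow_mul P j, mul_inv, mul_assoc, ← mul_assoc (P.mesh 0)⁻¹, inv_mul_cancel₀ (P.mesh_pos 0).ne', one_mul,
    div_eq_inv_mul]

/-- **Transfer**: kernel bounds at interior points give `Ineq210` for the region carrier. [cite: Balaban1983Higgs3, (2.10) p.426] -/
theorem ineq210_of_boundsR {δ₁ Cst : ℝ}
    (hv : ∀ (j : ℕ) (x x' : HiggsLattice.Site P 0), Interior k K₀ Ω x → Interior k K₀ Ω x' →
      (P.mesh 0 ^ P.d)⁻¹ * ∑ i' : Ix N, ‖pieceR C Ω A msq a k j (cb P N 0 (x', i')) x‖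
        ≤ Cst * (P.mesh j ^ 2 * (P.mesh j ^ P.d)⁻¹) *
          Real.exp (-(δ₁ * ((HiggsLattice.Site.tdist x x' : ℝ) / (P.L : ℝ) ^ j))))
    (hd : ∀ (j : ℕ) (μ : Fin P.d) (x x' : HiggsLattice.Site P 0), Interior k K₀ Ω x → Interior k K₀ Ω x' →
      (P.mesh 0 ^ P.d)⁻¹ * ∑ i' : Ix N, ‖covDeriv C A (pieceR C Ω A msq a k j (cb P N 0 (x', i'))) ⟨x, μ⟩‖
        ≤ Cst * (P.mesh j * (P.mesh j ^ P.d)⁻¹) *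
          Real.exp (-(δ₁ * ((HiggsLattice.Site.tdist x x' : ℝ) / (P.L : ℝ) ^ j)))) :
    (regRegionKernels hL1 C Ω A msq a k K₀).Ineq210 δ₁ Cst := by
  intro j x x'
  have e1 : (regRegionKernels hL1 C Ω A msq a k K₀).absG j x x'
      = (P.mesh 0 ^ P.d)⁻¹ * ∑ i' : Ix N, ‖pieceR C Ω A msq a k j (cb P N 0 (x'.1, i')) x.1‖ := rfl
  have e2 : ∀ μ : Fin P.d, (regRegionKernels hL1 C Ω A msq a k K₀).absDG j μ x x'
      = (P.mesh 0 ^ P.d)⁻¹ * ∑ i' : Ix N, ‖covDeriv C A (pieceR C Ω A msq a k j (cb P N 0 (x'.1, i'))) ⟨x.1, μ⟩‖ := fun _ => rfl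
  have e3 : (regRegionKernels hL1 C Ω A msq a k K₀).dist x x' = P.mesh 0 * (HiggsLattice.Site.tdist x.1 x'.1 : ℝ) := rfl
  have e4 : (regRegionKernels hL1 C Ω A msq a k K₀).d = P.d := rfl
  rw [scaleR_eq, e1, e3, e4, rpow_two_sub', rpow_one_sub', mul_assoc δ₁, scale_inv_mul_dist']
  refine ⟨hv j x.1 x'.1 x.2 x'.2, fun μ => ?_⟩
  rw [e2]
  exact hd j μ x.1 x'.1 x.2 x'.2

end CarrierR2

section MainR

open B1TorusCubeLocality26 (rS)
open B1TorusRegionRop (chi)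
open B2Eq337ScalarIntegration (Regions)
open B2Eq328ConcretePieces (pieceF)
open B3Ineq210RegularTorus (cst210 cst210_pos le_cst210_zero le_cst210_zero' le_cst210_pos le_cst210_pos')

/-- weakening in the exponent. [folklore] -/
private theorem exp_le_exp_of_le' {u v : ℝ} (h : v ≤ u) : Real.exp (-u) ≤ Real.exp (-v) :=
  Real.exp_le_exp.mpr (neg_le_neg h)

/-- p35's rate `D/(4K₀L^l)` dominates a common rate `δ ≤ 1/(4K₀)`. [folklore] -/
private theorem exp_p35_le {K₀ l : ℕ} (hK₀ : 0 < K₀) {δ D : ℝ} (hδ : δ ≤ 1 / (4 * K₀)) (hD : 0 ≤ D) (hLl : (0 : ℝ) < (P.L : ℝ) ^ l) :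
    Real.exp (-(D / (4 * K₀ * (P.L : ℝ) ^ l))) ≤ Real.exp (-(δ * (D / (P.L : ℝ) ^ l))) := by
  apply exp_le_exp_of_le'
  have hK : (0 : ℝ) < 4 * K₀ := by positivity
  have h1 : D / (4 * K₀ * (P.L : ℝ) ^ l) = 1 / (4 * K₀) * (D / (P.L : ℝ) ^ l) := by
    field_simp
  rw [h1]
  exact mul_le_mul_of_nonneg_right hδ (by positivity)

/-- **B3 (2.10) p. 426 [PDF 16] PROVED ON A REGION `Ω ⊊ T_η` AT A REGULAR NON-CONSTANT BACKGROUND `B̃ = A`, at interior points,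
uniformly in the volume.**  For `d ≥ 1`, `L ≥ 2`, `a, m² > 0`, a regularity constant `c ≥ 0` and `N` there is `E₀ > 0` such that for
every charge with `e² ≤ E₀` there is a threshold `K₀,min` and, for every `K₀ ≥ K₀,min`, constants `t, δ₁, C > 0` with: for every volume
`P` with these `d, L` and `K₀ ∣ M`, every scale `1 ≤ k ≤ K` with `L^kε ≤ 1` and `3L^kK₀ ≤ |T_ε|_μ`, every region `Ω ⊂ T_ε` that is a union
of big blocks (`IsBigBlockUnion k K₀ Ω`: cells of `L^kK₀` fine sites), and every configuration `A` that is `δ_A`-regular ON `Ω`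
(`|A⟨z+e_ν,μ⟩ − A⟨z,μ⟩| ≤ δ_A`, `z ∈ Ω`) with `L^kδ_A|e| ≤ t` and `L^kδ_A ≤ c|e|`:
`(regRegionKernels _ C Ω A m² a k K₀).Ineq210 δ₁ C` — i.e. (2.10) and its differentiated form for all `j` and all INTERIOR `x, x′`
(`Interior k K₀ Ω`: the ball of radius `2r_S + 2L^kK₀(d+1) + 1` around the point lies in `Ω` — print's `R₀`-clause of Prop. I.2.1).
Route = print's «rescaling … and application of Propositions I.2.1 and I.2.3»: pieces (2.6) = (I.2.43) for regions
(`B1Eq243HiggsModel.display243_model`), (I.2.25) at a regular `A` on big-block regions (p35 `B1Ineq225RegularRegion.norm_propagatorK_region_reg_decay_sum`,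
`B1Ineq225DerivRegularRegion.norm_covDeriv_propagatorK_region_reg_decay_sum`), (I.2.34) at a regular `A` on regions (r14 g14
`B1Prop23RegularRegion.prop23_regular_region`, read on `Λ = Ω^{(l)}` through `C^{(l)}_{Ω^{(l)}}(Ω,A) = 1_{Ω^{(l)}}C^{(l)}(Ω,A)`), the
block-diagonal form of the region operators (`B1Cor23RegularRegion.propagatorK_indicator_comm`: sources outside `Ω` do not reach `Ω`), and
the three-kernel convolution of `B3Ineq210RegularTorus`.  Honest scope: interior points only; `m² > 0`; `Ω` a big-block union with the
cube-count hypothesis and `K₀ ∣ M`; `e² ≤ E₀`; constants depend on `K₀` (and on the charge data through the inputs).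
[cite: Balaban1983Higgs3, (2.6) p.424, (2.10) p.426] [cite: Balaban1982Higgs1, Prop. 2.1 (2.25) p.610, Prop. 2.3 (2.34) p.611, (2.43) p.612] -/
theorem ineq210_regularRegion (d L : ℕ) (hd : 1 ≤ d) (hL : 2 ≤ L) {a : ℝ} (ha : 0 < a) {msq : ℝ} (hmsq : 0 < msq)
    {c : ℝ} (hc : 0 ≤ c) (N : ℕ) :
    ∃ E₀ : ℝ, 0 < E₀ ∧ ∀ (C : ChargeData N), C.e ^ 2 ≤ E₀ →
      ∃ K₀min : ℕ, ∀ K₀ : ℕ, K₀min ≤ K₀ → ∃ t δ₁ Cst : ℝ, 0 < t ∧ 0 < δ₁ ∧ 0 < Cst ∧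
      ∀ (P : HiggsLattice.Params) (hP1 : 1 < P.L), P.d = d → P.L = L → K₀ ∣ P.M →
      ∀ {k : ℕ}, 1 ≤ k → k ≤ P.K → (∀ μ, 3 * half P k K₀ ≤ P.sitesPerDir 0 μ) → P.mesh k ≤ 1 →
      ∀ (Ω : Finset (HiggsLattice.Site P 0)), IsBigBlockUnion k K₀ Ω →
      ∀ (A : HiggsLattice.VecField P 0) {δA : ℝ}, 0 ≤ δA →
        (∀ z ∈ Ω, ∀ μ ν : Fin P.d, |A ⟨z.shift ν, μ⟩ - A ⟨z, μ⟩| ≤ δA) →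
        (P.L : ℝ) ^ k * δA * |C.e| ≤ t → (P.L : ℝ) ^ k * δA ≤ c * |C.e| →
        (regRegionKernels hP1 C Ω A msq a k K₀).Ineq210 δ₁ Cst := by
  have hL1 : 1 < L := by omega
  obtain ⟨E₀, c₁, ρ₃, hE₀, hc₁, hρ₃, hCov⟩ := B1Prop23RegularRegion.prop23_regular_region d L hL1 ha hmsq hc N
  refine ⟨E₀, hE₀, fun C heE => ?_⟩
  obtain ⟨K₁, hV⟩ :=
    B1Ineq225RegularRegion.norm_propagatorK_region_reg_decay_sum d L hd hL ha hmsq N C 1 1 1 zero_le_one one_pos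
  obtain ⟨K₂, hD⟩ :=
    B1Ineq225DerivRegularRegion.norm_covDeriv_propagatorK_region_reg_decay_sum d L hd hL ha hmsq N C 1 1 1 zero_le_one one_pos
  refine ⟨max (max K₁ K₂) 1, fun K₀ hK₀ => ?_⟩
  have hK₁ : K₁ ≤ K₀ := ((le_max_left _ _).trans (le_max_left _ _)).trans hK₀
  have hK₂ : K₂ ≤ K₀ := ((le_max_right _ _).trans (le_max_left _ _)).trans hK₀
  have hK₀1 : 1 ≤ K₀ := (le_max_right _ _).trans hK₀
  obtain ⟨c₀, e₁, hc₀, he₁, hV⟩ := hV K₀ hK₁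
  obtain ⟨c₀', e₂, hc₀', he₂, hD⟩ := hD K₀ hK₂
  -- the common rate, the smallness threshold and the constant
  obtain ⟨δ, hδ⟩ : ∃ δ : ℝ, δ = min (1 / (4 * (K₀ : ℝ))) ρ₃ := ⟨_, rfl⟩
  have hδpos : 0 < δ := by rw [hδ]; exact lt_min (by positivity) hρ₃
  have hδ₁ : δ ≤ 1 / (4 * K₀) := by rw [hδ]; exact min_le_left _ _
  have hδ₃ : δ ≤ ρ₃ := by rw [hδ]; exact min_le_right _ _
  have hLpos : (0 : ℝ) < L := by exact_mod_cast (by omega : 0 < L)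
  refine ⟨min e₁ e₂, δ / (2 * L), cst210 d L N a c₀ c₀' c₁ δ, lt_min he₁ he₂, div_pos hδpos (by positivity),
    cst210_pos hc₀.le hc₀'.le hc₁.le, ?_⟩
  intro P hP1 hPd hPL hK₀M k hk1 hkK h3 hmesh Ω hΩ A δA hδA hreg ht hcA
  subst hPd hPL
  have hL1' : 1 < P.L := hP1
  have hLr : 1 < (P.L : ℝ) := by exact_mod_cast hL1'
  have hLge1 : (1 : ℝ) ≤ P.L := hLr.le
  have hCst : 0 ≤ cst210 P.d P.L N a c₀ c₀' c₁ δ := (cst210_pos hc₀.le hc₀'.le hc₁.le).le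
  have hte₁ : (P.L : ℝ) ^ k * δA * |C.e| ≤ e₁ := ht.trans (min_le_left _ _)
  have hte₂ : (P.L : ℝ) ^ k * δA * |C.e| ≤ e₂ := ht.trans (min_le_right _ _)
  -- block-union facts at every level `l ≤ k`
  have hΩl : ∀ {l : ℕ}, l ≤ k → ∀ x x' : HiggsLattice.Site P 0, blockIter l x = blockIter l x' → (x ∈ Ω ↔ x' ∈ Ω) :=
    fun hl => blockUnion_of_isBigBlockUnion hl hΩ
  -- (I.2.25) value at level `l`, engine form, at interior points
  have hGl : ∀ {l : ℕ}, 1 ≤ l → l ≤ k → ∀ (g : ScalarField P 0 N) (M D : ℝ), (∀ x, ‖g x‖ ≤ M) → 0 ≤ D →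
      ∀ x, Interior k K₀ Ω x → (∀ z, g z ≠ 0 → D ≤ (HiggsLattice.Site.tdist x z : ℝ)) →
        ‖propagatorK C Ω A msq a l g x‖ ≤ c₀ * P.mesh l ^ 2 * Real.exp (-(δ * (D / (P.L : ℝ) ^ l))) * M := by
    intro l hl1 hlk g M D hg hD0 x hx hsupp
    have hmesh_l : P.mesh l ≤ 1 := (B3Ineq210RegularTorus.mesh_mono P hlk).trans hmesh
    have h3l : ∀ μ, 3 * half P l K₀ ≤ P.sitesPerDir 0 μ := fun μ => (Nat.mul_le_mul_left _ (half_mono hlk)).trans (h3 μ)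
    have hak : 0 ≤ B1.aSeq a P.L l := (B1.aSeq_pos ha hLr hl1).le
    have h := hV P rfl rfl hK₀M hl1 (hlk.trans hkK) h3l hmesh_l Ω (isBigBlockUnion_of_le hlk hΩ) A he₁ le_rfl
      (reg223R_of_small C Ω A hlk hmesh_l he₁ hδA hreg hte₁ le_rfl) x (hx.margin hlk) g M D hg hD0 hsupp
    rw [← propagatorK_apply_eq_chi C A hmsq hak (hΩl hlk) g hx.mem] at h
    refine h.trans ?_
    have hM : 0 ≤ M := (norm_nonneg _).trans (hg x)
    have hLl : (0 : ℝ) < (P.L : ℝ) ^ l := pow_pos (by exact_mod_cast P.hL) l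
    have hexp := exp_p35_le (P := P) (by omega : 0 < K₀) hδ₁ hD0 hLl
    exact mul_le_mul_of_nonneg_right (mul_le_mul_of_nonneg_left hexp (by positivity)) hM
  -- (I.2.25) derivative at level `l`
  have hDl : ∀ {l : ℕ}, 1 ≤ l → l ≤ k → ∀ (g : ScalarField P 0 N) (M D : ℝ), (∀ x, ‖g x‖ ≤ M) → 0 ≤ D →
      ∀ b : HiggsLattice.PBond P 0, Interior k K₀ Ω b.src → (∀ z, g z ≠ 0 → D ≤ (HiggsLattice.Site.tdist b.src z : ℝ)) →
        ‖covDeriv C A (propagatorK C Ω A msq a l g) b‖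
          ≤ c₀' * P.mesh l * Real.exp (-(δ * (D / (P.L : ℝ) ^ l))) * M := by
    intro l hl1 hlk g M D hg hD0 b hb hsupp
    have hmesh_l : P.mesh l ≤ 1 := (B3Ineq210RegularTorus.mesh_mono P hlk).trans hmesh
    have h3l : ∀ μ, 3 * half P l K₀ ≤ P.sitesPerDir 0 μ := fun μ => (Nat.mul_le_mul_left _ (half_mono hlk)).trans (h3 μ)
    have hak : 0 ≤ B1.aSeq a P.L l := (B1.aSeq_pos ha hLr hl1).le
    have h := hD P rfl rfl hK₀M hl1 (hlk.trans hkK) h3l hmesh_l Ω (isBigBlockUnion_of_le hlk hΩ) A he₂ le_rfl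
      (reg223R_of_small C Ω A hlk hmesh_l he₂ hδA hreg hte₂ le_rfl) b.src b.dir (hb.margin' hlk) g M D hg hD0 hsupp
    -- `G(1_Ωg)` and `Gg` agree on `Ω ∋ b₋, b₊`
    have hcut : ∀ y ∈ Ω, propagatorK C Ω A msq a l (chi Ω • g) y = propagatorK C Ω A msq a l g y :=
      fun y hy => (propagatorK_apply_eq_chi C A hmsq hak (hΩl hlk) g hy).symm
    have hbb : (⟨b.src, b.dir⟩ : HiggsLattice.PBond P 0) = b := rfl
    rw [hbb] at h
    have hb' : covDeriv C A (propagatorK C Ω A msq a l (chi Ω • g)) b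
        = covDeriv C A (propagatorK C Ω A msq a l g) b := by
      have h1 : propagatorK C Ω A msq a l (chi Ω • g) b.tgt = propagatorK C Ω A msq a l g b.tgt :=
        hcut _ (hb.shift_mem b.dir)
      have h2 : propagatorK C Ω A msq a l (chi Ω • g) b.src = propagatorK C Ω A msq a l g b.src := hcut _ hb.mem
      rw [B1Cor23RegularRegion.covDeriv_eq, B1Cor23RegularRegion.covDeriv_eq, h1, h2]
    rw [hb'] at h
    refine h.trans ?_
    have hM : 0 ≤ M := (norm_nonneg _).trans (hg b.src)
    have hml : 0 < P.mesh l := P.mesh_pos l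
    have hLl : (0 : ℝ) < (P.L : ℝ) ^ l := pow_pos (by exact_mod_cast P.hL) l
    have hexp := exp_p35_le (P := P) (by omega : 0 < K₀) hδ₁ hD0 hLl
    exact mul_le_mul_of_nonneg_right (mul_le_mul_of_nonneg_left hexp (by positivity)) hM
  -- (I.2.34) at level `l < k` on `Ω^{(l)} × Ω^{(l)}`
  have hCl : ∀ {l : ℕ}, 1 ≤ l → l < k → ∀ s t : HiggsLattice.Site P l × Ix N, s.1 ∈ levelSet l Ω → t.1 ∈ levelSet l Ω →
      |mat (fluctCovA C Ω A msq a l) s t| ≤ c₁ * P.mesh l ^ 2 * Real.exp (-(δ * (HiggsLattice.Site.tdist s.1 t.1 : ℝ))) := by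
    intro l hl1 hlk s t hs ht'
    obtain ⟨j, rfl⟩ : ∃ j, l = j + 1 := ⟨l - 1, by omega⟩
    have hmesh_l : P.mesh (j + 1) ≤ 1 := (B3Ineq210RegularTorus.mesh_mono P hlk.le).trans hmesh
    have hjK : j + 1 < P.K := lt_of_lt_of_le hlk hkK
    have hcl : (P.L : ℝ) ^ (j + 1) * δA ≤ c * |C.e| := by
      have hpow : (P.L : ℝ) ^ (j + 1) ≤ (P.L : ℝ) ^ k := pow_le_pow_right₀ hLge1 hlk.le
      nlinarith
    -- the constant tower of height `k`, index `j`
    have hjk : j < k := by omega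
    have hpf : pieceF (towerR Ω k) ⟨j, hjk⟩ = Ω := pieceF_towerR ⟨j, hjk⟩ (hΩl hlk.le)
    have hregF : ∀ z ∈ pieceF (towerR Ω k) ⟨j, hjk⟩, ∀ μ' ν : Fin P.d, |A ⟨z.shift ν, μ'⟩ - A ⟨z, μ'⟩| ≤ δA := by
      rw [hpf]; exact hreg
    have hj2 : j + 2 ≤ k := by omega
    have hΛ := levelSet_blockUnion hjK.le (hΩl hlk.le) (hΩl hj2)
    have h := (hCov C heE P rfl rfl (towerR Ω k) hkK ⟨j, hjk⟩ hjK hmesh_l hΛ A hδA hregF hcl (Λ := levelSet (j + 1) Ω)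
      (subset_refl _) hs ht').1
    rw [hpf, mat_condCov232_levelSet C A hjK.le hmsq ha hLr (hΩl hlk.le) (hΩl hj2) hs] at h
    refine h.trans ?_
    have hexp : Real.exp (-(ρ₃ * (HiggsLattice.Site.tdist s.1 t.1 : ℝ))) ≤ Real.exp (-(δ * (HiggsLattice.Site.tdist s.1 t.1 : ℝ))) :=
      exp_le_exp_of_le' (mul_le_mul_of_nonneg_right hδ₃ (Nat.cast_nonneg _))
    calc P.mesh (j + 1) ^ 2 * c₁ * Real.exp (-(ρ₃ * (HiggsLattice.Site.tdist s.1 t.1 : ℝ)))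
        ≤ P.mesh (j + 1) ^ 2 * c₁ * Real.exp (-(δ * (HiggsLattice.Site.tdist s.1 t.1 : ℝ))) :=
          mul_le_mul_of_nonneg_left hexp (by positivity)
      _ = _ := by ring
  -- rate bookkeeping
  have hrate : δ / (2 * P.L) ≤ δ / 2 := by
    rw [div_le_div_iff₀ (by positivity) (by norm_num : (0 : ℝ) < 2)]
    nlinarith
  have hexp0 : ∀ x x' : HiggsLattice.Site P 0,
      Real.exp (-(δ * ((HiggsLattice.Site.tdist x x' : ℝ) / (P.L : ℝ) ^ 1)))
        ≤ Real.exp (-(δ / (2 * P.L) * ((HiggsLattice.Site.tdist x x' : ℝ) / (P.L : ℝ) ^ 0))) := by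
    intro x x'
    apply exp_le_exp_of_le'
    rw [pow_one, pow_zero, div_one]
    have h0 : 0 ≤ δ * ((HiggsLattice.Site.tdist x x' : ℝ) / P.L) := by positivity
    calc δ / (2 * P.L) * (HiggsLattice.Site.tdist x x' : ℝ) = (1 / 2) * (δ * ((HiggsLattice.Site.tdist x x' : ℝ) / P.L)) := by
          ring
      _ ≤ δ * ((HiggsLattice.Site.tdist x x' : ℝ) / P.L) := by linarith
  have hexpj : ∀ (j : ℕ) (x x' : HiggsLattice.Site P 0),
      Real.exp (-(δ / 2 * ((HiggsLattice.Site.tdist x x' : ℝ) / (P.L : ℝ) ^ j)))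
        ≤ Real.exp (-(δ / (2 * P.L) * ((HiggsLattice.Site.tdist x x' : ℝ) / (P.L : ℝ) ^ j))) :=
    fun j x x' => exp_le_exp_of_le' (mul_le_mul_of_nonneg_right hrate (by positivity))
  have hgood : ∀ x, Interior k K₀ Ω x → x ∈ Ω := fun x hx => hx.mem
  have hgood' : ∀ (x : HiggsLattice.Site P 0) (μ : Fin P.d), Interior k K₀ Ω x → x.shift μ ∈ Ω := fun x μ hx => hx.shift_mem μ
  refine ineq210_of_boundsR (fun j x x' hx hx' => ?_) (fun j μ x x' hx hx' => ?_)
  · have hmj : 0 < P.mesh j := P.mesh_pos j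
    rcases Nat.eq_zero_or_pos j with rfl | hj1
    · refine (absG_pieceR_zero_le C Ω A msq (k := k) (hGl le_rfl hk1) hx x').trans ?_
      exact mul_le_mul (mul_le_mul_of_nonneg_right (le_cst210_zero hc₀.le hc₀'.le hc₁.le) (by positivity)) (hexp0 x x')
        (Real.exp_pos _).le (by positivity)
    · by_cases hjk : j < k
      · refine (absG_pieceR_pos_le C Ω A msq ha hL1' hj1 hjk (hjk.le.trans hkK) hmsq (hΩl hjk.le) hgood hc₀.le hc₁.le
          hδpos (hGl hj1 hjk.le) (hCl hj1 hjk) hx hx').trans ?_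
        exact mul_le_mul (mul_le_mul_of_nonneg_right (le_cst210_pos hc₀.le hc₀'.le hc₁.le) (by positivity)) (hexpj j x x')
          (Real.exp_pos _).le (by positivity)
      · rw [absG_pieceR_ge_eq_zero C Ω A msq hj1 (not_lt.mp hjk)]
        positivity
  · have hmj : 0 < P.mesh j := P.mesh_pos j
    rcases Nat.eq_zero_or_pos j with rfl | hj1
    · refine (absDG_pieceR_zero_le C Ω A msq (k := k) (hDl le_rfl hk1) μ hx x').trans ?_
      exact mul_le_mul (mul_le_mul_of_nonneg_right (le_cst210_zero' hc₀.le hc₀'.le hc₁.le) (by positivity)) (hexp0 x x')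
        (Real.exp_pos _).le (by positivity)
    · by_cases hjk : j < k
      · refine (absDG_pieceR_pos_le C Ω A msq ha hL1' hj1 hjk (hjk.le.trans hkK) hmsq (hΩl hjk.le) hgood hgood' hc₀.le
          hc₀'.le hc₁.le hδpos (hGl hj1 hjk.le) (hDl hj1 hjk.le) (hCl hj1 hjk) μ hx hx').trans ?_
        exact mul_le_mul (mul_le_mul_of_nonneg_right (le_cst210_pos' hc₀.le hc₀'.le hc₁.le) (by positivity)) (hexpj j x x')
          (Real.exp_pos _).le (by positivity)
      · rw [absDG_pieceR_ge_eq_zero C Ω A msq hj1 (not_lt.mp hjk)]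
        positivity

/-- **The same, un-subtyped**: (2.10) on the region for every `j` and all `x, x′ ∈ T_ε` carrying the interior margin, in the model's units
(`(L^jε)^{2−d}`, `(L^jε)^{1−d}`, rate `δ₁(L^jε)^{−1}·ε|x − x′|`) — the form consumers on the full lattice use; it makes the relation to the torus
member `B3Ineq210RegularTorus.ineq210_regularTorus` (no margin) visible. [cite: Balaban1983Higgs3, (2.10) p.426]
[cite: Balaban1982Higgs1, Prop. 2.1 p.610] -/
theorem ineq210_regularRegion_explicit (d L : ℕ) (hd : 1 ≤ d) (hL : 2 ≤ L) {a : ℝ} (ha : 0 < a) {msq : ℝ} (hmsq : 0 < msq)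
    {c : ℝ} (hc : 0 ≤ c) (N : ℕ) :
    ∃ E₀ : ℝ, 0 < E₀ ∧ ∀ (C : ChargeData N), C.e ^ 2 ≤ E₀ →
      ∃ K₀min : ℕ, ∀ K₀ : ℕ, K₀min ≤ K₀ → ∃ t δ₁ Cst : ℝ, 0 < t ∧ 0 < δ₁ ∧ 0 < Cst ∧
      ∀ (P : HiggsLattice.Params), 1 < P.L → P.d = d → P.L = L → K₀ ∣ P.M →
      ∀ {k : ℕ}, 1 ≤ k → k ≤ P.K → (∀ μ, 3 * half P k K₀ ≤ P.sitesPerDir 0 μ) → P.mesh k ≤ 1 →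
      ∀ (Ω : Finset (HiggsLattice.Site P 0)), IsBigBlockUnion k K₀ Ω →
      ∀ (A : HiggsLattice.VecField P 0) {δA : ℝ}, 0 ≤ δA →
        (∀ z ∈ Ω, ∀ μ ν : Fin P.d, |A ⟨z.shift ν, μ⟩ - A ⟨z, μ⟩| ≤ δA) →
        (P.L : ℝ) ^ k * δA * |C.e| ≤ t → (P.L : ℝ) ^ k * δA ≤ c * |C.e| →
        ∀ (j : ℕ) (x x' : HiggsLattice.Site P 0), Interior k K₀ Ω x → Interior k K₀ Ω x' →
          (P.mesh 0 ^ P.d)⁻¹ * ∑ i' : Ix N, ‖pieceR C Ω A msq a k j (cb P N 0 (x', i')) x‖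
              ≤ Cst * P.mesh j ^ ((2 : ℝ) - (P.d : ℝ)) *
                Real.exp (-(δ₁ * (P.mesh j)⁻¹ * (P.mesh 0 * (HiggsLattice.Site.tdist x x' : ℝ)))) ∧
          ∀ μ : Fin P.d, (P.mesh 0 ^ P.d)⁻¹ * ∑ i' : Ix N, ‖covDeriv C A (pieceR C Ω A msq a k j (cb P N 0 (x', i'))) ⟨x, μ⟩‖
              ≤ Cst * P.mesh j ^ ((1 : ℝ) - (P.d : ℝ)) *
                Real.exp (-(δ₁ * (P.mesh j)⁻¹ * (P.mesh 0 * (HiggsLattice.Site.tdist x x' : ℝ)))) := by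
  obtain ⟨E₀, hE₀, h⟩ := ineq210_regularRegion d L hd hL ha hmsq hc N
  refine ⟨E₀, hE₀, fun C heE => ?_⟩
  obtain ⟨K₀min, h⟩ := h C heE
  refine ⟨K₀min, fun K₀ hK₀ => ?_⟩
  obtain ⟨t, δ₁, Cst, ht, hδ₁, hCst, h⟩ := h K₀ hK₀
  refine ⟨t, δ₁, Cst, ht, hδ₁, hCst, ?_⟩
  intro P hP1 hPd hPL hK₀M k hk1 hkK h3 hmesh Ω hΩ A δA hδA hreg ht' hcA j x x' hx hx'
  have h' := h P hP1 hPd hPL hK₀M hk1 hkK h3 hmesh Ω hΩ A hδA hreg ht' hcA j ⟨x, hx⟩ ⟨x', hx'⟩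
  rw [scaleR_eq] at h'
  exact h'

end MainR

/-! ## §4R The full torus as a region, and non-vacuity of the hypotheses with a proper region -/

section UnivR

open B1TorusCubeLocality26 (rS)
open B1TorusRegionHSizes (isBigBlockUnion_univ)

/-- Every point of the full torus is interior. [cite: Balaban1982Higgs1, Prop. 2.1 p.610] -/
theorem interior_univ {k K₀ : ℕ} (x : HiggsLattice.Site P 0) : Interior k K₀ (Finset.univ : Finset (HiggsLattice.Site P 0)) x :=
  fun y _ => Finset.mem_univ y

/-- **(2.10) on the FULL torus `Ω = T_ε` at a regular non-constant background, EVERY `L ≥ 2`** (no parity hypothesis): the case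
`Ω = univ` of `ineq210_regularRegion` (`IsBigBlockUnion` holds for the whole torus, every point is interior).  Complements the odd-`L`
torus member `B3Ineq210RegularTorus.ineq210_regularTorus` (which has no `e² ≤ E₀` / `L^kδ_A ≤ c|e|` conditions).
[cite: Balaban1983Higgs3, (2.10) p.426] [cite: Balaban1982Higgs1, Prop. 2.1 p.610, Prop. 2.3 p.611] -/
theorem ineq210_regularRegion_univ (d L : ℕ) (hd : 1 ≤ d) (hL : 2 ≤ L) {a : ℝ} (ha : 0 < a) {msq : ℝ} (hmsq : 0 < msq)
    {c : ℝ} (hc : 0 ≤ c) (N : ℕ) :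
    ∃ E₀ : ℝ, 0 < E₀ ∧ ∀ (C : ChargeData N), C.e ^ 2 ≤ E₀ →
      ∃ K₀min : ℕ, ∀ K₀ : ℕ, K₀min ≤ K₀ → ∃ t δ₁ Cst : ℝ, 0 < t ∧ 0 < δ₁ ∧ 0 < Cst ∧
      ∀ (P : HiggsLattice.Params) (hP1 : 1 < P.L), P.d = d → P.L = L → K₀ ∣ P.M →
      ∀ {k : ℕ}, 1 ≤ k → k ≤ P.K → (∀ μ, 3 * half P k K₀ ≤ P.sitesPerDir 0 μ) → P.mesh k ≤ 1 →
      ∀ (A : HiggsLattice.VecField P 0) {δA : ℝ}, 0 ≤ δA →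
        (∀ (z : HiggsLattice.Site P 0) (μ ν : Fin P.d), |A ⟨z.shift ν, μ⟩ - A ⟨z, μ⟩| ≤ δA) →
        (P.L : ℝ) ^ k * δA * |C.e| ≤ t → (P.L : ℝ) ^ k * δA ≤ c * |C.e| →
        (regRegionKernels hP1 C Finset.univ A msq a k K₀).Ineq210 δ₁ Cst := by
  obtain ⟨E₀, hE₀, h⟩ := ineq210_regularRegion d L hd hL ha hmsq hc N
  refine ⟨E₀, hE₀, fun C heE => ?_⟩
  obtain ⟨K₀min, h⟩ := h C heE
  refine ⟨K₀min, fun K₀ hK₀ => ?_⟩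
  obtain ⟨t, δ₁, Cst, ht, hδ₁, hCst, h⟩ := h K₀ hK₀
  refine ⟨t, δ₁, Cst, ht, hδ₁, hCst, ?_⟩
  intro P hP1 hPd hPL hK₀M k hk1 hkK h3 hmesh A δA hδA hreg ht' hcA
  exact h P hP1 hPd hPL hK₀M hk1 hkK h3 hmesh Finset.univ isBigBlockUnion_univ A hδA (fun z _ μ ν => hreg z μ ν) ht' hcA

/-- kernel: the torus coordinate distance from a base label `ρ` controls the label. [folklore] -/
private theorem val_le_of_min_le {n₀ ρ : ℕ} [NeZero n₀] (hρ : ρ < n₀) {b : ZMod n₀}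
    (h : min (((ρ : ℕ) : ZMod n₀) - b).val (b - ((ρ : ℕ) : ZMod n₀)).val ≤ ρ) : b.val ≤ 2 * ρ := by
  have ha : (((ρ : ℕ) : ZMod n₀)).val = ρ := ZMod.val_cast_of_lt hρ
  have hb : b.val < n₀ := ZMod.val_lt b
  rcases le_or_gt b.val ρ with hle | hlt
  · omega
  · have hba : (b - ((ρ : ℕ) : ZMod n₀)).val = b.val - ρ := by
      rw [ZMod.val_sub (by rw [ha]; exact hlt.le), ha]
    have hne : b - ((ρ : ℕ) : ZMod n₀) ≠ 0 := by
      intro h0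
      have := congrArg ZMod.val h0
      rw [hba, ZMod.val_zero] at this
      omega
    have hab : (((ρ : ℕ) : ZMod n₀) - b).val = n₀ - (b.val - ρ) := by
      rw [← neg_sub, ZMod.neg_val, if_neg hne, hba]
    rw [hab, hba] at h
    rcases min_le_iff.mp h with h1 | h1
    · omega
    · omega

/-- **Non-vacuity of the hypotheses of `ineq210_regularRegion` with a PROPER region whose interior is non-empty.**  For `d ≥ 1`,
`L ≥ 2` and every threshold `K₀,min` there are `K₀ ≥ K₀,min` and a volume `P` with these `d, L`, `K₀ ∣ M`, `1 ≤ K`, at scale `k = 1`: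
`3·half ≤ |T_ε|_μ` in every direction and `Lε ≤ 1`, together with a big-block union `Ω ≠ T_ε` (a slab of cells) and a point `x` with
`Interior 1 K₀ Ω x`; the field hypotheses hold at `A = 0`, `δ_A = 0` (for every `t > 0`, `c ≥ 0`, every charge).  So the family of
`ineq210_regularRegion` contains proper regions with interior points at every admissible cube size.
[cite: Balaban1983Higgs3, (2.10) p.426] [cite: Balaban1982Higgs1, (1.2) p.604, Prop. 2.1 p.610] -/
theorem regularRegion_hypotheses_nonvacuous (d L : ℕ) (hd : 1 ≤ d) (hL : 2 ≤ L) (K₀min : ℕ) :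
    ∃ K₀ : ℕ, K₀min ≤ K₀ ∧ ∃ (P : HiggsLattice.Params), 1 < P.L ∧ P.d = d ∧ P.L = L ∧ K₀ ∣ P.M ∧ 1 ≤ P.K ∧
      (∀ μ, 3 * half P 1 K₀ ≤ P.sitesPerDir 0 μ) ∧ P.mesh 1 ≤ 1 ∧
      ∃ Ω : Finset (HiggsLattice.Site P 0), IsBigBlockUnion 1 K₀ Ω ∧ Ω ≠ Finset.univ ∧ (∃ x, Interior 1 K₀ Ω x) ∧
        ∀ z ∈ Ω, ∀ μ ν : Fin P.d,
          |(0 : HiggsLattice.VecField P 0) ⟨z.shift ν, μ⟩ - (0 : HiggsLattice.VecField P 0) ⟨z, μ⟩| ≤ 0 := by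
  have hL0 : 0 < L := by omega
  -- the cube size, the margin `ρ₀`, the slab width `n` (cells) and the volume
  obtain ⟨K₀, hK₀, hK₀1⟩ : ∃ K₀, K₀min ≤ K₀ ∧ 1 ≤ K₀ := ⟨max K₀min 1, le_max_left _ _, le_max_right _ _⟩
  obtain ⟨ρ₀, hρ₀⟩ : ∃ ρ₀ : ℕ, ρ₀ = 2 * (5 * (L ^ 1 * K₀) / 8 + L ^ 1) + 2 * (L ^ 1 * K₀) * (d + 1) + 1 := ⟨_, rfl⟩
  obtain ⟨n, hn⟩ : ∃ n : ℕ, n = 2 * ρ₀ + 1 := ⟨_, rfl⟩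
  have hn3 : 3 ≤ n := by omega
  have hLK : 1 ≤ L * K₀ := Nat.one_le_iff_ne_zero.mpr (Nat.mul_ne_zero (by omega) (by omega))
  let P : HiggsLattice.Params :=
    ⟨d, ((L : ℝ))⁻¹, 1, L, K₀ * n, fun _ => 1, hd, by positivity, hL0, Nat.mul_pos (by omega) (by omega), fun _ => one_pos⟩
  have hhalf : half P 1 K₀ = L * K₀ := by show L ^ 1 * K₀ = L * K₀; rw [pow_one]
  have hsites : ∀ μ : Fin d, P.sitesPerDir 0 μ = 2 * (L * (K₀ * n)) := by
    intro μ; show 2 * (L ^ (1 - 0) * (K₀ * n) * 1) = _; rw [Nat.sub_zero, pow_one, mul_one]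
  have hhalf_pos : 0 < half P 1 K₀ := by rw [hhalf]; omega
  refine ⟨K₀, hK₀, P, lt_of_lt_of_le (by norm_num) hL, rfl, rfl, Dvd.intro n rfl, le_rfl, ?_, ?_, ?_⟩
  · intro μ
    rw [hhalf, hsites μ]
    calc 3 * (L * K₀) ≤ n * (L * K₀) := Nat.mul_le_mul_right _ hn3
      _ = L * (K₀ * n) := by ring
      _ ≤ 2 * (L * (K₀ * n)) := Nat.le_mul_of_pos_left _ (by norm_num)
  · show (L : ℝ) ^ 1 * ((L : ℝ))⁻¹ ≤ 1
    rw [pow_one, mul_inv_cancel₀ (by exact_mod_cast hL0.ne')]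
  -- the slab `Ω` of `n` cells in direction `μ₀`
  let μ₀ : Fin d := ⟨0, hd⟩
  refine ⟨Finset.univ.filter (fun x : HiggsLattice.Site P 0 => (x μ₀).val / half P 1 K₀ < n), ?_, ?_, ?_, ?_⟩
  · intro x x' h
    simp only [Finset.mem_filter, Finset.mem_univ, true_and]
    rw [h μ₀]
  · -- proper: the site with label `n·half` in direction `μ₀` is outside
    intro hΩ
    have hlt : n * half P 1 K₀ < P.sitesPerDir 0 μ₀ := by
      rw [hhalf, hsites μ₀]
      calc n * (L * K₀) = L * (K₀ * n) := by ring
        _ < 2 * (L * (K₀ * n)) := by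
          have : 0 < L * (K₀ * n) := Nat.mul_pos hL0 (Nat.mul_pos (by omega) (by omega))
          omega
    let z : HiggsLattice.Site P 0 := fun μ => ((n * half P 1 K₀ : ℕ) : ZMod (P.sitesPerDir 0 μ))
    have hz : z ∈ Finset.univ.filter (fun x : HiggsLattice.Site P 0 => (x μ₀).val / half P 1 K₀ < n) := by
      rw [hΩ]; exact Finset.mem_univ z
    rw [Finset.mem_filter] at hz
    have hval : (z μ₀).val = n * half P 1 K₀ := ZMod.val_cast_of_lt hlt
    have := hz.2
    rw [hval, Nat.mul_div_cancel _ hhalf_pos] at this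
    exact lt_irrefl _ this
  · -- the point with all labels `ρ₀` is interior
    have hρn : ∀ μ : Fin d, ρ₀ < P.sitesPerDir 0 μ := by
      intro μ; rw [hsites μ]
      have : ρ₀ * 1 ≤ ρ₀ * (L * K₀) := Nat.mul_le_mul_left _ hLK
      calc ρ₀ < n := by omega
        _ ≤ n * (L * K₀) := by nlinarith
        _ = L * (K₀ * n) := by ring
        _ ≤ 2 * (L * (K₀ * n)) := by omega
    refine ⟨fun μ => ((ρ₀ : ℕ) : ZMod (P.sitesPerDir 0 μ)), fun y hy => ?_⟩
    have hmargin : 2 * rS P 1 K₀ + 2 * half P 1 K₀ * (P.d + 1) + 1 = ρ₀ := by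
      rw [hρ₀]; rfl
    rw [hmargin] at hy
    rw [Finset.mem_filter]
    refine ⟨Finset.mem_univ _, ?_⟩
    have hμ : min ((((ρ₀ : ℕ) : ZMod (P.sitesPerDir 0 μ₀))) - y μ₀).val (y μ₀ - ((ρ₀ : ℕ) : ZMod (P.sitesPerDir 0 μ₀))).val ≤ ρ₀ :=
      (Finset.le_sup (f := fun μ : Fin P.d =>
        min ((((ρ₀ : ℕ) : ZMod (P.sitesPerDir 0 μ))) - y μ).val (y μ - ((ρ₀ : ℕ) : ZMod (P.sitesPerDir 0 μ))).val)
        (Finset.mem_univ μ₀)).trans hy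
    have hb : (y μ₀).val ≤ 2 * ρ₀ := val_le_of_min_le (hρn μ₀) hμ
    calc (y μ₀).val / half P 1 K₀ ≤ (y μ₀).val := Nat.div_le_self _ _
      _ < n := by omega
  · intro z _ μ ν
    simp

end UnivR

/-! ## §5R (v1.2) ONE SMALLNESS PARAMETER: (2.10) on regions with the single condition `L^kδ_A·|e| ≤ t` (no `e² ≤ E₀`, no `L^kδ_A ≤ c|e|`)

The (I.2.34) input of `ineq210_regularRegion` is r14 g14's `B1Prop23RegularRegion.prop23_regular_region`, whose smallness is packaged
as `e² ≤ E₀ ∧ L^kδ_A ≤ c|e|` ((I.2.23) in lattice units); p35 g16's `B1Prop23RegularRegionSmall.prop23_regular_region_small` (same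
conclusion, same carriers) discharges it from the ONE product condition `L^kδ_A·|e| ≤ t₀` — the currency of the (I.2.25) inputs and of
the torus member `B3Ineq210RegularTorus.ineq210_regularTorus`.  Swapping that input gives (2.10) on regions for EVERY charge (no
`E₀`) and without the ratio condition; the quantifier shape becomes that of the torus member (threshold `K₀,min` after the charge
data — the shape of p35's (I.2.25) — then `t, δ₁, C` after `K₀`).  The proof is the proof of `ineq210_regularRegion` verbatim except
for the (I.2.34) block.  Nothing else changes; the `(E₀, c)` theorems above stay (their consumers are landed).
-/

section SmallR

open B1TorusCubeLocality26 (rS)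
open B1TorusRegionRop (chi)
open B1TorusRegionHSizes (isBigBlockUnion_univ)
open B2Eq337ScalarIntegration (Regions)
open B2Eq328ConcretePieces (pieceF)
open B3Ineq210RegularTorus (cst210 cst210_pos le_cst210_zero le_cst210_zero' le_cst210_pos le_cst210_pos')

/-- **B3 (2.10) p. 426 ON A REGION AT A REGULAR NON-CONSTANT BACKGROUND, ONE SMALLNESS PARAMETER.**  For `d ≥ 1`, `L ≥ 2`,
`a, m² > 0`, `N` and EVERY charge there is a threshold `K₀,min` and, for every `K₀ ≥ K₀,min`, constants `t, δ₁, C > 0` with: for every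
volume `P` with these `d, L` and `K₀ ∣ M`, every scale `1 ≤ k ≤ K` with `L^kε ≤ 1` and `3L^kK₀ ≤ |T_ε|_μ`, every big-block union
`Ω ⊂ T_ε` (`IsBigBlockUnion k K₀ Ω`) and every `A` that is `δ_A`-regular ON `Ω` with the SINGLE smallness condition `L^kδ_A·|e| ≤ t`
(print's *"for e(L^kε) sufficiently small"*, Prop. I.2.1, in the (I.2.23) currency): `(regRegionKernels _ C Ω A m² a k K₀).Ineq210 δ₁ C`
— (2.10) and its differentiated form for all `j` at all interior `x, x′`.  Same route and same scope as `ineq210_regularRegion`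
(interior points only; `m² > 0`; big-block unions with the cube-count hypothesis and `K₀ ∣ M`; constants depend on `K₀` and, through
the (I.2.25) thresholds, on the charge data), with the (I.2.34) input now p35's `B1Prop23RegularRegionSmall.prop23_regular_region_small`.
[cite: Balaban1983Higgs3, (2.6) p.424, (2.10) p.426] [cite: Balaban1982Higgs1, Prop. 2.1 (2.23), (2.25) p.610, Prop. 2.3 (2.34) p.611, (2.43) p.612] -/
theorem ineq210_regularRegion_small (d L : ℕ) (hd : 1 ≤ d) (hL : 2 ≤ L) {a : ℝ} (ha : 0 < a) {msq : ℝ} (hmsq : 0 < msq)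
    (N : ℕ) (C : ChargeData N) :
    ∃ K₀min : ℕ, ∀ K₀ : ℕ, K₀min ≤ K₀ → ∃ t δ₁ Cst : ℝ, 0 < t ∧ 0 < δ₁ ∧ 0 < Cst ∧
      ∀ (P : HiggsLattice.Params) (hP1 : 1 < P.L), P.d = d → P.L = L → K₀ ∣ P.M →
      ∀ {k : ℕ}, 1 ≤ k → k ≤ P.K → (∀ μ, 3 * half P k K₀ ≤ P.sitesPerDir 0 μ) → P.mesh k ≤ 1 →
      ∀ (Ω : Finset (HiggsLattice.Site P 0)), IsBigBlockUnion k K₀ Ω →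
      ∀ (A : HiggsLattice.VecField P 0) {δA : ℝ}, 0 ≤ δA →
        (∀ z ∈ Ω, ∀ μ ν : Fin P.d, |A ⟨z.shift ν, μ⟩ - A ⟨z, μ⟩| ≤ δA) →
        (P.L : ℝ) ^ k * δA * |C.e| ≤ t →
        (regRegionKernels hP1 C Ω A msq a k K₀).Ineq210 δ₁ Cst := by
  have hL1 : 1 < L := by omega
  obtain ⟨t₀, c₁, ρ₃, ht₀, hc₁, hρ₃, hCov⟩ := B1Prop23RegularRegionSmall.prop23_regular_region_small d L hL1 ha hmsq N
  obtain ⟨K₁, hV⟩ :=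
    B1Ineq225RegularRegion.norm_propagatorK_region_reg_decay_sum d L hd hL ha hmsq N C 1 1 1 zero_le_one one_pos
  obtain ⟨K₂, hD⟩ :=
    B1Ineq225DerivRegularRegion.norm_covDeriv_propagatorK_region_reg_decay_sum d L hd hL ha hmsq N C 1 1 1 zero_le_one one_pos
  refine ⟨max (max K₁ K₂) 1, fun K₀ hK₀ => ?_⟩
  have hK₁ : K₁ ≤ K₀ := ((le_max_left _ _).trans (le_max_left _ _)).trans hK₀
  have hK₂ : K₂ ≤ K₀ := ((le_max_right _ _).trans (le_max_left _ _)).trans hK₀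
  have hK₀1 : 1 ≤ K₀ := (le_max_right _ _).trans hK₀
  obtain ⟨c₀, e₁, hc₀, he₁, hV⟩ := hV K₀ hK₁
  obtain ⟨c₀', e₂, hc₀', he₂, hD⟩ := hD K₀ hK₂
  -- the common rate, the smallness threshold and the constant
  obtain ⟨δ, hδ⟩ : ∃ δ : ℝ, δ = min (1 / (4 * (K₀ : ℝ))) ρ₃ := ⟨_, rfl⟩
  have hδpos : 0 < δ := by rw [hδ]; exact lt_min (by positivity) hρ₃
  have hδ₁ : δ ≤ 1 / (4 * K₀) := by rw [hδ]; exact min_le_left _ _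
  have hδ₃ : δ ≤ ρ₃ := by rw [hδ]; exact min_le_right _ _
  have hLpos : (0 : ℝ) < L := by exact_mod_cast (by omega : 0 < L)
  refine ⟨min (min e₁ e₂) t₀, δ / (2 * L), cst210 d L N a c₀ c₀' c₁ δ, lt_min (lt_min he₁ he₂) ht₀, div_pos hδpos (by positivity),
    cst210_pos hc₀.le hc₀'.le hc₁.le, ?_⟩
  intro P hP1 hPd hPL hK₀M k hk1 hkK h3 hmesh Ω hΩ A δA hδA hreg ht
  subst hPd hPL
  have hL1' : 1 < P.L := hP1
  have hLr : 1 < (P.L : ℝ) := by exact_mod_cast hL1'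
  have hLge1 : (1 : ℝ) ≤ P.L := hLr.le
  have hCst : 0 ≤ cst210 P.d P.L N a c₀ c₀' c₁ δ := (cst210_pos hc₀.le hc₀'.le hc₁.le).le
  have hte₁ : (P.L : ℝ) ^ k * δA * |C.e| ≤ e₁ := ht.trans ((min_le_left _ _).trans (min_le_left _ _))
  have hte₂ : (P.L : ℝ) ^ k * δA * |C.e| ≤ e₂ := ht.trans ((min_le_left _ _).trans (min_le_right _ _))
  have htt₀ : (P.L : ℝ) ^ k * δA * |C.e| ≤ t₀ := ht.trans (min_le_right _ _)
  -- block-union facts at every level `l ≤ k`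
  have hΩl : ∀ {l : ℕ}, l ≤ k → ∀ x x' : HiggsLattice.Site P 0, blockIter l x = blockIter l x' → (x ∈ Ω ↔ x' ∈ Ω) :=
    fun hl => blockUnion_of_isBigBlockUnion hl hΩ
  -- (I.2.25) value at level `l`, engine form, at interior points
  have hGl : ∀ {l : ℕ}, 1 ≤ l → l ≤ k → ∀ (g : ScalarField P 0 N) (M D : ℝ), (∀ x, ‖g x‖ ≤ M) → 0 ≤ D →
      ∀ x, Interior k K₀ Ω x → (∀ z, g z ≠ 0 → D ≤ (HiggsLattice.Site.tdist x z : ℝ)) →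
        ‖propagatorK C Ω A msq a l g x‖ ≤ c₀ * P.mesh l ^ 2 * Real.exp (-(δ * (D / (P.L : ℝ) ^ l))) * M := by
    intro l hl1 hlk g M D hg hD0 x hx hsupp
    have hmesh_l : P.mesh l ≤ 1 := (B3Ineq210RegularTorus.mesh_mono P hlk).trans hmesh
    have h3l : ∀ μ, 3 * half P l K₀ ≤ P.sitesPerDir 0 μ := fun μ => (Nat.mul_le_mul_left _ (half_mono hlk)).trans (h3 μ)
    have hak : 0 ≤ B1.aSeq a P.L l := (B1.aSeq_pos ha hLr hl1).le
    have h := hV P rfl rfl hK₀M hl1 (hlk.trans hkK) h3l hmesh_l Ω (isBigBlockUnion_of_le hlk hΩ) A he₁ le_rfl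
      (reg223R_of_small C Ω A hlk hmesh_l he₁ hδA hreg hte₁ le_rfl) x (hx.margin hlk) g M D hg hD0 hsupp
    rw [← propagatorK_apply_eq_chi C A hmsq hak (hΩl hlk) g hx.mem] at h
    refine h.trans ?_
    have hM : 0 ≤ M := (norm_nonneg _).trans (hg x)
    have hLl : (0 : ℝ) < (P.L : ℝ) ^ l := pow_pos (by exact_mod_cast P.hL) l
    have hexp := exp_p35_le (P := P) (by omega : 0 < K₀) hδ₁ hD0 hLl
    exact mul_le_mul_of_nonneg_right (mul_le_mul_of_nonneg_left hexp (by positivity)) hM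
  -- (I.2.25) derivative at level `l`
  have hDl : ∀ {l : ℕ}, 1 ≤ l → l ≤ k → ∀ (g : ScalarField P 0 N) (M D : ℝ), (∀ x, ‖g x‖ ≤ M) → 0 ≤ D →
      ∀ b : HiggsLattice.PBond P 0, Interior k K₀ Ω b.src → (∀ z, g z ≠ 0 → D ≤ (HiggsLattice.Site.tdist b.src z : ℝ)) →
        ‖covDeriv C A (propagatorK C Ω A msq a l g) b‖
          ≤ c₀' * P.mesh l * Real.exp (-(δ * (D / (P.L : ℝ) ^ l))) * M := by
    intro l hl1 hlk g M D hg hD0 b hb hsupp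
    have hmesh_l : P.mesh l ≤ 1 := (B3Ineq210RegularTorus.mesh_mono P hlk).trans hmesh
    have h3l : ∀ μ, 3 * half P l K₀ ≤ P.sitesPerDir 0 μ := fun μ => (Nat.mul_le_mul_left _ (half_mono hlk)).trans (h3 μ)
    have hak : 0 ≤ B1.aSeq a P.L l := (B1.aSeq_pos ha hLr hl1).le
    have h := hD P rfl rfl hK₀M hl1 (hlk.trans hkK) h3l hmesh_l Ω (isBigBlockUnion_of_le hlk hΩ) A he₂ le_rfl
      (reg223R_of_small C Ω A hlk hmesh_l he₂ hδA hreg hte₂ le_rfl) b.src b.dir (hb.margin' hlk) g M D hg hD0 hsupp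
    -- `G(1_Ωg)` and `Gg` agree on `Ω ∋ b₋, b₊`
    have hcut : ∀ y ∈ Ω, propagatorK C Ω A msq a l (chi Ω • g) y = propagatorK C Ω A msq a l g y :=
      fun y hy => (propagatorK_apply_eq_chi C A hmsq hak (hΩl hlk) g hy).symm
    have hbb : (⟨b.src, b.dir⟩ : HiggsLattice.PBond P 0) = b := rfl
    rw [hbb] at h
    have hb' : covDeriv C A (propagatorK C Ω A msq a l (chi Ω • g)) b
        = covDeriv C A (propagatorK C Ω A msq a l g) b := by
      have h1 : propagatorK C Ω A msq a l (chi Ω • g) b.tgt = propagatorK C Ω A msq a l g b.tgt :=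
        hcut _ (hb.shift_mem b.dir)
      have h2 : propagatorK C Ω A msq a l (chi Ω • g) b.src = propagatorK C Ω A msq a l g b.src := hcut _ hb.mem
      rw [B1Cor23RegularRegion.covDeriv_eq, B1Cor23RegularRegion.covDeriv_eq, h1, h2]
    rw [hb'] at h
    refine h.trans ?_
    have hM : 0 ≤ M := (norm_nonneg _).trans (hg b.src)
    have hml : 0 < P.mesh l := P.mesh_pos l
    have hLl : (0 : ℝ) < (P.L : ℝ) ^ l := pow_pos (by exact_mod_cast P.hL) l
    have hexp := exp_p35_le (P := P) (by omega : 0 < K₀) hδ₁ hD0 hLl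
    exact mul_le_mul_of_nonneg_right (mul_le_mul_of_nonneg_left hexp (by positivity)) hM
  -- (I.2.34) at level `l < k` on `Ω^{(l)} × Ω^{(l)}`, ONE SMALLNESS PARAMETER (p35's `prop23_regular_region_small`)
  have hCl : ∀ {l : ℕ}, 1 ≤ l → l < k → ∀ s t : HiggsLattice.Site P l × Ix N, s.1 ∈ levelSet l Ω → t.1 ∈ levelSet l Ω →
      |mat (fluctCovA C Ω A msq a l) s t| ≤ c₁ * P.mesh l ^ 2 * Real.exp (-(δ * (HiggsLattice.Site.tdist s.1 t.1 : ℝ))) := by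
    intro l hl1 hlk s t hs ht'
    obtain ⟨j, rfl⟩ : ∃ j, l = j + 1 := ⟨l - 1, by omega⟩
    have hmesh_l : P.mesh (j + 1) ≤ 1 := (B3Ineq210RegularTorus.mesh_mono P hlk.le).trans hmesh
    have hjK : j + 1 < P.K := lt_of_lt_of_le hlk hkK
    have htl : (P.L : ℝ) ^ (j + 1) * δA * |C.e| ≤ t₀ := by
      have hpow : (P.L : ℝ) ^ (j + 1) ≤ (P.L : ℝ) ^ k := pow_le_pow_right₀ hLge1 hlk.le
      have h0 : 0 ≤ δA * |C.e| := by positivity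
      calc (P.L : ℝ) ^ (j + 1) * δA * |C.e| = (P.L : ℝ) ^ (j + 1) * (δA * |C.e|) := by ring
        _ ≤ (P.L : ℝ) ^ k * (δA * |C.e|) := mul_le_mul_of_nonneg_right hpow h0
        _ = (P.L : ℝ) ^ k * δA * |C.e| := by ring
        _ ≤ t₀ := htt₀
    -- the constant tower of height `k`, index `j`
    have hjk : j < k := by omega
    have hpf : pieceF (towerR Ω k) ⟨j, hjk⟩ = Ω := pieceF_towerR ⟨j, hjk⟩ (hΩl hlk.le)
    have hregF : ∀ z ∈ pieceF (towerR Ω k) ⟨j, hjk⟩, ∀ μ' ν : Fin P.d, |A ⟨z.shift ν, μ'⟩ - A ⟨z, μ'⟩| ≤ δA := by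
      rw [hpf]; exact hreg
    have hj2 : j + 2 ≤ k := by omega
    have hΛ := levelSet_blockUnion hjK.le (hΩl hlk.le) (hΩl hj2)
    have h := (hCov C P rfl rfl (towerR Ω k) hkK ⟨j, hjk⟩ hjK hmesh_l hΛ A hδA hregF htl (Λ := levelSet (j + 1) Ω)
      (subset_refl _) hs ht').1
    rw [hpf, mat_condCov232_levelSet C A hjK.le hmsq ha hLr (hΩl hlk.le) (hΩl hj2) hs] at h
    refine h.trans ?_
    have hexp : Real.exp (-(ρ₃ * (HiggsLattice.Site.tdist s.1 t.1 : ℝ))) ≤ Real.exp (-(δ * (HiggsLattice.Site.tdist s.1 t.1 : ℝ))) :=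
      exp_le_exp_of_le' (mul_le_mul_of_nonneg_right hδ₃ (Nat.cast_nonneg _))
    calc P.mesh (j + 1) ^ 2 * c₁ * Real.exp (-(ρ₃ * (HiggsLattice.Site.tdist s.1 t.1 : ℝ)))
        ≤ P.mesh (j + 1) ^ 2 * c₁ * Real.exp (-(δ * (HiggsLattice.Site.tdist s.1 t.1 : ℝ))) :=
          mul_le_mul_of_nonneg_left hexp (by positivity)
      _ = _ := by ring
  -- rate bookkeeping
  have hrate : δ / (2 * P.L) ≤ δ / 2 := by
    rw [div_le_div_iff₀ (by positivity) (by norm_num : (0 : ℝ) < 2)]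
    nlinarith
  have hexp0 : ∀ x x' : HiggsLattice.Site P 0,
      Real.exp (-(δ * ((HiggsLattice.Site.tdist x x' : ℝ) / (P.L : ℝ) ^ 1)))
        ≤ Real.exp (-(δ / (2 * P.L) * ((HiggsLattice.Site.tdist x x' : ℝ) / (P.L : ℝ) ^ 0))) := by
    intro x x'
    apply exp_le_exp_of_le'
    rw [pow_one, pow_zero, div_one]
    have h0 : 0 ≤ δ * ((HiggsLattice.Site.tdist x x' : ℝ) / P.L) := by positivity
    calc δ / (2 * P.L) * (HiggsLattice.Site.tdist x x' : ℝ) = (1 / 2) * (δ * ((HiggsLattice.Site.tdist x x' : ℝ) / P.L)) := by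
          ring
      _ ≤ δ * ((HiggsLattice.Site.tdist x x' : ℝ) / P.L) := by linarith
  have hexpj : ∀ (j : ℕ) (x x' : HiggsLattice.Site P 0),
      Real.exp (-(δ / 2 * ((HiggsLattice.Site.tdist x x' : ℝ) / (P.L : ℝ) ^ j)))
        ≤ Real.exp (-(δ / (2 * P.L) * ((HiggsLattice.Site.tdist x x' : ℝ) / (P.L : ℝ) ^ j))) :=
    fun j x x' => exp_le_exp_of_le' (mul_le_mul_of_nonneg_right hrate (by positivity))
  have hgood : ∀ x, Interior k K₀ Ω x → x ∈ Ω := fun x hx => hx.mem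
  have hgood' : ∀ (x : HiggsLattice.Site P 0) (μ : Fin P.d), Interior k K₀ Ω x → x.shift μ ∈ Ω := fun x μ hx => hx.shift_mem μ
  refine ineq210_of_boundsR (fun j x x' hx hx' => ?_) (fun j μ x x' hx hx' => ?_)
  · have hmj : 0 < P.mesh j := P.mesh_pos j
    rcases Nat.eq_zero_or_pos j with rfl | hj1
    · refine (absG_pieceR_zero_le C Ω A msq (k := k) (hGl le_rfl hk1) hx x').trans ?_
      exact mul_le_mul (mul_le_mul_of_nonneg_right (le_cst210_zero hc₀.le hc₀'.le hc₁.le) (by positivity)) (hexp0 x x')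
        (Real.exp_pos _).le (by positivity)
    · by_cases hjk : j < k
      · refine (absG_pieceR_pos_le C Ω A msq ha hL1' hj1 hjk (hjk.le.trans hkK) hmsq (hΩl hjk.le) hgood hc₀.le hc₁.le
          hδpos (hGl hj1 hjk.le) (hCl hj1 hjk) hx hx').trans ?_
        exact mul_le_mul (mul_le_mul_of_nonneg_right (le_cst210_pos hc₀.le hc₀'.le hc₁.le) (by positivity)) (hexpj j x x')
          (Real.exp_pos _).le (by positivity)
      · rw [absG_pieceR_ge_eq_zero C Ω A msq hj1 (not_lt.mp hjk)]
        positivity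
  · have hmj : 0 < P.mesh j := P.mesh_pos j
    rcases Nat.eq_zero_or_pos j with rfl | hj1
    · refine (absDG_pieceR_zero_le C Ω A msq (k := k) (hDl le_rfl hk1) μ hx x').trans ?_
      exact mul_le_mul (mul_le_mul_of_nonneg_right (le_cst210_zero' hc₀.le hc₀'.le hc₁.le) (by positivity)) (hexp0 x x')
        (Real.exp_pos _).le (by positivity)
    · by_cases hjk : j < k
      · refine (absDG_pieceR_pos_le C Ω A msq ha hL1' hj1 hjk (hjk.le.trans hkK) hmsq (hΩl hjk.le) hgood hgood' hc₀.le
          hc₀'.le hc₁.le hδpos (hGl hj1 hjk.le) (hDl hj1 hjk.le) (hCl hj1 hjk) μ hx hx').trans ?_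
        exact mul_le_mul (mul_le_mul_of_nonneg_right (le_cst210_pos' hc₀.le hc₀'.le hc₁.le) (by positivity)) (hexpj j x x')
          (Real.exp_pos _).le (by positivity)
      · rw [absDG_pieceR_ge_eq_zero C Ω A msq hj1 (not_lt.mp hjk)]
        positivity

/-- **The same, un-subtyped, one smallness parameter**: (2.10) on the region for every `j` and all `x, x′ ∈ T_ε` carrying the interior
margin, in the model's units — the form of `ineq210_regularRegion_explicit` with the single condition `L^kδ_A·|e| ≤ t`.
[cite: Balaban1983Higgs3, (2.10) p.426] [cite: Balaban1982Higgs1, Prop. 2.1 (2.23) p.610] -/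
theorem ineq210_regularRegion_explicit_small (d L : ℕ) (hd : 1 ≤ d) (hL : 2 ≤ L) {a : ℝ} (ha : 0 < a) {msq : ℝ} (hmsq : 0 < msq)
    (N : ℕ) (C : ChargeData N) :
    ∃ K₀min : ℕ, ∀ K₀ : ℕ, K₀min ≤ K₀ → ∃ t δ₁ Cst : ℝ, 0 < t ∧ 0 < δ₁ ∧ 0 < Cst ∧
      ∀ (P : HiggsLattice.Params), 1 < P.L → P.d = d → P.L = L → K₀ ∣ P.M →
      ∀ {k : ℕ}, 1 ≤ k → k ≤ P.K → (∀ μ, 3 * half P k K₀ ≤ P.sitesPerDir 0 μ) → P.mesh k ≤ 1 →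
      ∀ (Ω : Finset (HiggsLattice.Site P 0)), IsBigBlockUnion k K₀ Ω →
      ∀ (A : HiggsLattice.VecField P 0) {δA : ℝ}, 0 ≤ δA →
        (∀ z ∈ Ω, ∀ μ ν : Fin P.d, |A ⟨z.shift ν, μ⟩ - A ⟨z, μ⟩| ≤ δA) →
        (P.L : ℝ) ^ k * δA * |C.e| ≤ t →
        ∀ (j : ℕ) (x x' : HiggsLattice.Site P 0), Interior k K₀ Ω x → Interior k K₀ Ω x' →
          (P.mesh 0 ^ P.d)⁻¹ * ∑ i' : Ix N, ‖pieceR C Ω A msq a k j (cb P N 0 (x', i')) x‖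
              ≤ Cst * P.mesh j ^ ((2 : ℝ) - (P.d : ℝ)) *
                Real.exp (-(δ₁ * (P.mesh j)⁻¹ * (P.mesh 0 * (HiggsLattice.Site.tdist x x' : ℝ)))) ∧
          ∀ μ : Fin P.d, (P.mesh 0 ^ P.d)⁻¹ * ∑ i' : Ix N, ‖covDeriv C A (pieceR C Ω A msq a k j (cb P N 0 (x', i'))) ⟨x, μ⟩‖
              ≤ Cst * P.mesh j ^ ((1 : ℝ) - (P.d : ℝ)) *
                Real.exp (-(δ₁ * (P.mesh j)⁻¹ * (P.mesh 0 * (HiggsLattice.Site.tdist x x' : ℝ)))) := by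
  obtain ⟨K₀min, h⟩ := ineq210_regularRegion_small d L hd hL ha hmsq N C
  refine ⟨K₀min, fun K₀ hK₀ => ?_⟩
  obtain ⟨t, δ₁, Cst, ht, hδ₁, hCst, h⟩ := h K₀ hK₀
  refine ⟨t, δ₁, Cst, ht, hδ₁, hCst, ?_⟩
  intro P hP1 hPd hPL hK₀M k hk1 hkK h3 hmesh Ω hΩ A δA hδA hreg ht' j x x' hx hx'
  have h' := h P hP1 hPd hPL hK₀M hk1 hkK h3 hmesh Ω hΩ A hδA hreg ht' j ⟨x, hx⟩ ⟨x', hx'⟩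
  rw [scaleR_eq] at h'
  exact h'

/-- **(2.10) on the FULL torus `Ω = T_ε` at a regular non-constant background, every `L ≥ 2`, ONE SMALLNESS PARAMETER**: the case
`Ω = univ` of `ineq210_regularRegion_small` — the no-parity, every-charge form of the torus statement (the odd-`L` member
`B3Ineq210RegularTorus.ineq210_regularTorus` has the same single condition; `ineq210_regularRegion_univ` above carries `(E₀, c)`).
[cite: Balaban1983Higgs3, (2.10) p.426] [cite: Balaban1982Higgs1, Prop. 2.1 (2.23) p.610, Prop. 2.3 p.611] -/
theorem ineq210_regularRegion_univ_small (d L : ℕ) (hd : 1 ≤ d) (hL : 2 ≤ L) {a : ℝ} (ha : 0 < a) {msq : ℝ} (hmsq : 0 < msq)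
    (N : ℕ) (C : ChargeData N) :
    ∃ K₀min : ℕ, ∀ K₀ : ℕ, K₀min ≤ K₀ → ∃ t δ₁ Cst : ℝ, 0 < t ∧ 0 < δ₁ ∧ 0 < Cst ∧
      ∀ (P : HiggsLattice.Params) (hP1 : 1 < P.L), P.d = d → P.L = L → K₀ ∣ P.M →
      ∀ {k : ℕ}, 1 ≤ k → k ≤ P.K → (∀ μ, 3 * half P k K₀ ≤ P.sitesPerDir 0 μ) → P.mesh k ≤ 1 →
      ∀ (A : HiggsLattice.VecField P 0) {δA : ℝ}, 0 ≤ δA →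
        (∀ (z : HiggsLattice.Site P 0) (μ ν : Fin P.d), |A ⟨z.shift ν, μ⟩ - A ⟨z, μ⟩| ≤ δA) →
        (P.L : ℝ) ^ k * δA * |C.e| ≤ t →
        (regRegionKernels hP1 C Finset.univ A msq a k K₀).Ineq210 δ₁ Cst := by
  obtain ⟨K₀min, h⟩ := ineq210_regularRegion_small d L hd hL ha hmsq N C
  refine ⟨K₀min, fun K₀ hK₀ => ?_⟩
  obtain ⟨t, δ₁, Cst, ht, hδ₁, hCst, h⟩ := h K₀ hK₀
  refine ⟨t, δ₁, Cst, ht, hδ₁, hCst, ?_⟩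
  intro P hP1 hPd hPL hK₀M k hk1 hkK h3 hmesh A δA hδA hreg ht'
  exact h P hP1 hPd hPL hK₀M hk1 hkK h3 hmesh Finset.univ isBigBlockUnion_univ A hδA (fun z _ μ ν => hreg z μ ν) ht'

/-- **Non-vacuity of the hypotheses of `ineq210_regularRegion_small` with a proper region**: for `d ≥ 1`, `L ≥ 2` and every threshold
there are an admissible cube size, a volume, a proper big-block union with an interior point, and — at `A = 0`, `δ_A = 0` — the field
hypotheses for every `t > 0` and every charge (from `regularRegion_hypotheses_nonvacuous`; the single smallness condition reads
`L^k·0·|e| = 0 ≤ t`). [cite: Balaban1983Higgs3, (2.10) p.426] [cite: Balaban1982Higgs1, (1.2) p.604, Prop. 2.1 p.610] -/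
theorem regularRegion_small_hypotheses_nonvacuous (d L : ℕ) (hd : 1 ≤ d) (hL : 2 ≤ L) (K₀min : ℕ) {N : ℕ} (C : ChargeData N)
    {t : ℝ} (ht : 0 < t) :
    ∃ K₀ : ℕ, K₀min ≤ K₀ ∧ ∃ (P : HiggsLattice.Params), 1 < P.L ∧ P.d = d ∧ P.L = L ∧ K₀ ∣ P.M ∧ 1 ≤ P.K ∧
      (∀ μ, 3 * half P 1 K₀ ≤ P.sitesPerDir 0 μ) ∧ P.mesh 1 ≤ 1 ∧
      ∃ Ω : Finset (HiggsLattice.Site P 0), IsBigBlockUnion 1 K₀ Ω ∧ Ω ≠ Finset.univ ∧ (∃ x, Interior 1 K₀ Ω x) ∧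
        (∀ z ∈ Ω, ∀ μ ν : Fin P.d,
          |(0 : HiggsLattice.VecField P 0) ⟨z.shift ν, μ⟩ - (0 : HiggsLattice.VecField P 0) ⟨z, μ⟩| ≤ 0) ∧
        (P.L : ℝ) ^ 1 * (0 : ℝ) * |C.e| ≤ t := by
  obtain ⟨K₀, hK₀, P, hP1, hPd, hPL, hM, hK, h3, hmesh, Ω, hΩ, hne, hx, hreg⟩ :=
    regularRegion_hypotheses_nonvacuous d L hd hL K₀min
  exact ⟨K₀, hK₀, P, hP1, hPd, hPL, hM, hK, h3, hmesh, Ω, hΩ, hne, hx, hreg, by rw [mul_zero, zero_mul]; exact ht.le⟩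

end SmallR

end Literature.MathematicalPhysics.QuantumFieldTheory.Balaban1983to89.B3Ineq210RegularRegion

end
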